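import Summits.AtomisticToContinuum.HydrodynamicLimit.Theses.AntiMazurCoboundaries
import Literature.Analysis.FluidPDE.HardSphereEuclideanAlexander
import Literature.Analysis.FluidPDE.BoltzmannGradLimitProofs
import Literature.Analysis.FluidPDE.BBGKYMarginalsPartitionProofs
import Literature.Analysis.UnboundedOperators.LinearizedBoltzmannBurnettProofs
import Literature.Analysis.FluidPDE.HardSphereUniqueness

/-!
# Disproof of `CellForecastPressureDecay` — findings

Standing-adversary work file for the crux `AntiMazurCoboundaries.CellForecastPressureDecay`
(stmt-AtomisticToContinuum-13915, the N-free core of the route), seats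
`refuter-cdisprove-stmt-AtomisticToContinuum-13915-0` (cycle 1, §§ 1–7) and `…-13915-g2-0` (cycle 2,
§§ 8–10 and the Targets block at the end of the file), 2026-08-16. Everything below is sorry-free EXCEPT the single documented near-miss of § 7
(all-amplitudes, paper argument only).
LANDED COPIES (import these rather than this work file): § 1–2 =
`Summits/…/Theorems/CellForecastPressureDecay/Negative/WithoutOrthogonality.lean` (p73681, namespace
`Summit.AtomisticToContinuum.HydrodynamicLimit.Theorems.CellForecastPressureDecay`); § 3–4 =
`…/Negative/LoneParticle.lean` (p73994); § 5–6 = `…/Negative/PerParticle.lean` (p74445). All three ACCEPTED 2026-08-16.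
§ 8 = `…/Negative/AllTilts.lean` (p81797, ACCEPTED, commit ff8170762cc9), § 9 =
`…/Negative/IsolatedParticles.lean` (infrastructure up to `sum_indicator_le_cruxIntegrand`, p81743, ACCEPTED,
commit 59064a3dec10) + `…/Negative/FixedRange.lean` (the variant and its refutation, p82304, ACCEPTED, commit
6915c5993c4d), § 10 = `…/Negative/FlowIndependence.lean` (p81086, ACCEPTED, commit 4dc5e62e12b8) — all
cycle 2, 2026-08-16.

THE CRUX. `∃ σ₀ ∀ σ ∈ (0,σ₀) ∃ κ ∀ g` (continuous, `|g| ≤ κ`, `g ⊥ span(1, v, |v|²)` in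
`L²(stdGaussian ℝ³)`) `∀ δ ∃ T ∃ R₀ ∀ R ≥ R₀ ∃ L₀ ∀ L ≥ L₀ ∀ n ≤ 2L³ ∀ Ψ ∀ |c| ≤ 1`:
`∫⁻ exp(2c ∑_{i<n} T⁻¹∫₀ᵀ g(v^{fc}_i(t)) dt) dP_{n,L} ≤ e^{δ L³}`, where `v^{fc}_i` is the velocity of
particle `i` along the ISOLATED Euclidean hard-sphere evolution (`Ψ k`, Alexander's flow of the
`k`-cluster) of the particles initially within distance `R` of `x_i` (`localClusterState`), and
`P_{n,L}` is the canonical Gibbs law of `n` spheres of diameter `σ` in `[0,L]³` with standard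
Maxwellian velocities (`particleLaw (Ψ n) (canonicalDensity … (1_{[0,L]³} ⊗ M))`).

FINDINGS.
* READ-BACK / JUNK AUDIT — no formalisation-level kill. (i) `HardSphereFlow` is a hypothesis
  structure but the Euclidean Alexander theorem is PROVED in the tree
  (`HardSphereFlow.nonempty_holds`, axioms `propext/Classical.choice/Quot.sound`), so the
  `∀ Ψ` is not vacuous and every `¬`-lemma below is UNCONDITIONAL (`Ψ k := (nonempty_holds hσ k).some`).
  (ii) The junk branch of `localClusterState` (cluster frozen off `(Ψ k).good`) is invisible: the
  law of the relabelled restricted configuration is `≪` Lebesgue on `D_σ^k` and `good` is conull;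
  two hard-sphere flows agree Liouville-a.e., so the truth value does not depend on `Ψ`.
  (iii) `n = 0` gives `∫⁻ 1 d(δ_pt) = 1 ≤ e^{δL³}`; `c = 0` likewise; a zero partition function would
  make `P_{n,L} = 0` (trivially true) but § 1 PROVES `𝒵 > 0` and `P_{n,L}` a probability measure
  for `σ ≤ 3/16`, `L ≥ 1`, `n ≤ 2L³`; non-measurable / non-integrable time integrands only lower
  the left side (Bochner junk `0 ⇒ e⁰`). (iv) `globalMaxwellian` on `V3` (finrank 3) is the
  `stdGaussian` density: the orthogonality measure matches the velocity law.
* § 1 (PROVED) FRAME: the cell Gibbs law is a genuine probability measure —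
  `canonicalPartition_cell_pos`, `isProbabilityMeasure_cellLaw` (explicit grid of admissible
  configurations, spacing `1/4`, balls of radius `1/32`). Provers need exactly this.
* § 2 (PROVED) LOAD-BEARING: the orthogonality clause cannot be dropped —
  `cellForecastPressureDecay_false_without_orthogonality` (witness `g ≡ κ`: the time average of a
  constant along ANY forecast is the constant; `δ = κ`, `n = ⌊L³⌋`, `c = 1`, `L = max L₀ 2`).
* § 3–4 (PROVED) SMALL MODEL `n = 1`: a range cluster with one particle is evolved by a 1-particle
  hard-sphere flow, which is FREE FLIGHT (fields `free` + `flow_zero`: no pair, no collision time;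
  off the good set the cluster is frozen) — `vel_localClusterState_of_card_le_one`; hence for `n = 1`
  the window average is `g(v)` at EVERY horizon `T` (`windowAverage_one`) and the crux functional is
  EXACTLY the static exponential moment `∫ M e^{2cg} dv` (`lintegral_cellLaw_one`: the one-particle
  cell law is `L⁻³ 1_{[0,L]³} ⊗ M`, the position integrates out). The functional is therefore
  non-degenerate and NOTHING but collisions can make it decay: the decay mechanism of the crux is
  100 % an interaction effect (certified form of the planner's "σ = 0 gas fails").
* § 5 (PROVED) A CERTIFIED ADMISSIBLE OBSERVABLE: `g_κ(v) = κ sin v₀ sin v₁` is continuous,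
  `|g_κ| ≤ κ`, and `⊥ span(1, v, |v|²)` in `L²(stdGaussian)` (`gW_orthogonal`, by the coordinate
  reflections `v₀ ↦ -v₀`, `v₁ ↦ -v₁`), with STRICT Jensen `∫ e^{2g_κ} dγ > 1` for `κ ≠ 0`
  (`one_lt_integral_exp_gW`). Provers/ideators can use it as a test observable.
* § 6 (PROVED) THE PER-VOLUME SLACK IS LOAD-BEARING: `CellForecastPressureDecayPerParticle` (the crux
  with `e^{δ n}` in place of `e^{δ L³}`, all else verbatim) is FALSE —
  `cellForecastPressureDecay_false_perParticle` (`n = 1`, `g = g_κ`, `c = 1`,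
  `δ = ½ log ∫ e^{2g_κ} dγ`). So the statement survives `n = O(1)` / dilute cells ONLY through the
  volume normalisation; any proof must gain from the density `n/L³`, i.e. from collisions.
* § 7 (PAPER near-miss, the only `sorry`) — the AMPLITUDE clause `∃ κ` is load-bearing on paper:
  energy-shell Donsker–Varadhan tilt (temperature `θ' ≠ 1` of the whole cell; isolated clusters
  conserve energy, bulk particles stay Maxwellian(θ') over `[0,T]` once `R ≫ T`): gain
  `2c n (E_{θ'} g)`, second order in `θ'-1` with coefficient `≤ C‖g‖_∞`, cost `n·(3/2)(θ'-1-log θ')`;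
  profitable iff `‖g‖_∞` exceeds an absolute threshold — so "all bounded `g`" is FALSE on paper while
  `κ < κ*` survives (torus twin: κ* ≈ 0.489, seat 10967). NOT formalisable with the present tree:
  the forecast dynamics does not preserve the cell law (clusters expand into vacuum), so the
  Gibbs-tilt argument needs finite speed of influence + ensemble equivalence.
* § 8 (PROVED, cycle 2) THE TILT CAP `|c| ≤ 1` IS LOAD-BEARING: `CellForecastPressureDecayAllTilts`
  (the crux with `|c| ≤ 1` dropped; `c` is the innermost quantifier, AFTER `L`) is FALSE —
  `cellForecastPressureDecay_false_allTilts` (`n = 1`, `g = g_κ`, `c = (L³+1−log γ{g>κ/2})/κ`,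
  Chebyshev: `∫ e^{2cg} dγ ≥ e^{cκ} γ{g > κ/2} = e^{L³+1}`). The effective amplitude is `|c|κ`.
  Conversely (remark for provers, not formalised): WITH the cap, the clause `∀ |c| ≤ 1` reduces to the
  single tilt `c = 1` — Jensen for the concave `x ↦ x^{|c|}` on the probability space `P_{n,L}` gives
  `∫ e^{2cX} dP ≤ (∫ e^{2 sgn(c) X} dP)^{|c|} ≤ e^{|c|δL³} ≤ e^{δL³}`, and `c = −1` is `c = 1` for the
  admissible observable `−g`.
* § 9 (PROVED, cycle 2) THE FIXED-RANGE FLOOR — first EXTENSIVE (`n ≍ L³`), dynamics-free negative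
  lemma: `CellForecastPressureDecayFixedRange` (the crux with `∀δ ∃T ∃R₀ ∀R≥R₀` replaced by
  `∃R₀ ∀δ ∃T ∀R≥R₀`, "one range for all tolerances"; implies the crux) is FALSE —
  `cellForecastPressureDecay_false_fixedRange`. ISOLATED PARTICLES NEVER THERMALISE: on the event
  "particle `i` in the core (side `ℓ−R`) of lattice cell `φ i`", `φ : Fin n ↪ cells` injective, every
  range-`R` cluster is a singleton, every forecast is free flight at EVERY `T`, the event contributes
  exactly `Z⁻¹((ℓ−R)³∫Me^{2g})ⁿ` (`lintegral_isoEvent`: density factorises on the cylinder event,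
  Fubini on `Config n`), the `m³!/(m³−n)!` events are disjoint (`sum_indicator_le_cruxIntegrand`), and
  `Z ≤ L^{3n}` (`canonicalPartition_cell_le`). With `ℓ = KR`, `n = ⌊m³/K⌋`, `K = ⌈8(1+λ)/λ⌉+2`,
  `λ = ∫e^{2g}dγ − 1`: `∫⁻e^{2∑A_i}dP ≥ ((1−1/K)⁴(1+λ))ⁿ ≥ (1+λ/2)ⁿ > e^{δL³}`, `δ = log(1+λ/2)/(4Kℓ³)`.
  MORAL: at fixed range the functional has a `T`-INDEPENDENT extensive floor `≍ λ⁵/R³` per volume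
  (the static LD cost of isolating a particle at density `ρ` is only `≍ ρ^{1/4}R^{3/4}`, → 0 as ρ → 0);
  "R₀ after δ" is load-bearing STATICALLY (quantitatively `R₀(δ)³ ≳ λ⁵/δ`), independently of the
  finite-speed-of-influence requirement `R₀ ≫ T`. The same cylinder-event technique (assignments to
  lattice cells + free flight + factorisation) is reusable by provers for LOWER bounds / tightness.
* § 10 (PROVED, cycle 2) `Ψ`-INDEPENDENCE: `lintegral_cruxFunctional_eq` — for ANY two families
  `Ψ, Ψ'` of Euclidean hard-sphere flow structures, any density `W`, range `R`, horizon `T ≥ 0`,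
  observable `g`, tilt `c`, the crux's left-hand side is the same (and the law `particleLaw (Ψ n) W` is
  definitionally flow-free). Ingredients: coordinate projections pull Lebesgue-null sets back
  (`volume_restrictTo_preimage_null`: split `Fin S.card ⊕ Fin Sᶜ.card ≃ Fin n`, `sumPiEquivProdPi`,
  `(vol ⊗ vol)(N × univ) = 0·∞ = 0`), hence a.s. EVERY sub-configuration is a good datum of `Ψ S.card`
  (`ae_restrictTo_mem_good`; good sets Liouville-conull, sub-configurations of hard-sphere configurations
  are hard-sphere configurations), and forward uniqueness of trajectories
  (`IsHardSphereTrajectory.unique_holds`) makes two cluster flows agree on common good data for `t ≥ 0`.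
  So the `∀ Ψ` of the crux is decoration: provers fix `Ψ k := (nonempty_holds hσ k).some`, refuters gain
  nothing from exotic (junk-laden) flow structures — the cycle-1/g47-2 paper audit is now a theorem.
* CYCLE-2 AUDIT (no kill): re-read `HardSphereFlow` (good ⊆ D_σ, Liouville-conull, `particleLaw =
  (vol|D).withDensity`), `rangeCluster` (`‖x_i − x_j‖ ≤ R`, `Euclidean.geometry_sepVec = x − y`),
  `clusterStateIn` junk (frozen off good: P-null on each level set `{rangeCluster = S}` since the
  restricted law is a coordinate projection of an a.c. law); Gaussian drift+cooling tilt family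
  `v ~ N(v_b, u²I)` (exact by Galilean covariance + time rescaling `t ↦ ut` of hard-sphere paths:
  cooling = shortening the horizon to `uT`): gain `≤ 2κ`, cost `|v_b|²/2 + (3/2)(u²−1−log u²)`, second
  order near `(0,1)` with `O(κ)` vs `O(1)` coefficients — killed by `κ` small, and at low density the
  cooling lever is dominated by the plain collisionless bound `C/(σ²T)`; dense/jammed or cold-beam LD
  events cost `≥ log(1/(ρσ³))` resp. `3 log(1/u)` per particle against gain `≤ 2κ`. Static (dynamics-free)
  events CANNOT refute the all-amplitudes variant § 7 either: their floor `≍ Λ⁵/(spacing)³` is beaten by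
  `R₀`/`T` chosen after `g` — § 7 genuinely needs bulk collisional stationarity.
* WHY THE CRUX RESISTS (for provers). The statement is the LD ("pressure `o(volume)`") decay of
  window-`T` time averages of a fast one-body observable in an EQUILIBRIUM dilute hard-sphere gas at
  FIXED `σ`, uniformly in the density `ρ = n/L³ ≤ 2`, with `T` chosen after `δ`. Every cheap
  regime is consistent: low density (my `n`): the collisionless fraction `e^{-νT}`, `ν ∝ ρσ²`, gives
  per-volume pressure `≲ sup_ρ ρ·min(Λ(2c), 4c²Var(g)/(νT)) ≲ C/(σ²T) → 0`, so `T(δ) ≍ κ/(σ²δ)` wins —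
  the per-VOLUME normalisation is exactly what makes `n = 0, 1` and dilute cells harmless (§ 6
  shows it is necessary); `R ≥ diam`: cluster = whole gas released into `ℝ³`, bulk unaffected for
  `L ≫ T`, rarefaction layer `O(L²T) ≪ δL³`; conserved shells (energy, momentum, angular momentum of
  isolated clusters) and long-wavelength hydrodynamic modes surviving `[0,T]`: second-order gain
  `≤ Cκ·(tilt)²` against a uniformly convex cost — killed by `κ` small; influence from the cluster
  edge: cost per corrupted forecast `≍ (R/T)² → ∞` (`R₀` after `T`). A counterexample needs a
  finite-entropy-density, kinetic-time-persistent NON-Maxwellian one-body velocity structure of 3-d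
  hard spheres at small density overlapping a bounded `g ⊥ (1,v,|v|²)` — a hidden extensive
  quasi-local charge; none is known (the exact witnesses, `d = 1` rods and the `σ = 0` gas, are
  excluded). The open content is the infinite kinetic validity horizon at fixed `σ` (BGSS reach
  `o((log|log ε|)^{1/4})` only as `ε → 0`).
* REFORMULATION FOR BOTH SIDES (cycle 2). By Donsker–Varadhan in the thermodynamic limit (T fixed
  before L), `L⁻³ log ∫⁻ e^{2c∑A_i} → sup_Q [2cρ_Q · T⁻¹∫₀ᵀ ⟨Q_t, g⟩ dt − h(Q|P)]` over translation-
  invariant laws `Q` of finite specific relative entropy `h(Q|P)`, `Q_t` the evolved law (the forecast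
  is the true dynamics for interior particles once `R ≫ T`). A Gibbsian tilt (other temperature / drift)
  is invariant but biases `g ⊥ (1,v,|v|²)` only at SECOND order (`O(κ s²)` against `h ≍ s²`): § 7. A
  LINEAR-order bias `M(1+εh)`, `h ⊥ invariants`, has `h(Q|P) ≍ ε²` against gain `≍ 2cρε⟨g,h⟩` and
  WOULD kill the crux for small ε — iff it persisted in Cesàro mean over kinetic times. So ¬crux ⟺
  (essentially) a finite-specific-entropy, translation-invariant state of the infinite dilute hard-sphere
  dynamics whose one-body velocity marginal stays non-Maxwellian to first order for all times — a
  non-Gibbsian invariant (or sub-kinetically relaxing) state; equivalently a first-order dynamical phase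
  transition AT zero tilt for the time-integrated observable. Rigidity results in print cover only
  Gibbs-type invariant states (Gurevich–Suhov, "Stationary solutions of the Bogoliubov hierarchy
  equations in classical statistical mechanics" I–IV, e.g. III: Comm. Math. Phys. 56 (1977) 225–236;
  Genovese–Simonella, J. Stat. Phys. 148 (2012) 89–112 — citations verified from the reference list of
  arXiv:2102.12202, not re-read this seat); nothing excludes or produces the non-Gibbsian object. This is
  the `entropy-ball-invariant-states` card's transfer seen from the refuter's side: a disproof and a proof
  need the same missing theorem with opposite signs.
-/

open MeasureTheory Set Metric Filter ProbabilityTheory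
open scoped ENNReal InnerProductSpace
open Literature.Analysis.FluidPDE Literature.MathematicalPhysics.KineticTheory
open Literature.Analysis.UnboundedOperators (inner_basis_reflection_flip integral_stdGaussian_eq_zero_of_odd
  isOpenPosMeasure_stdGaussian integrable_one_add_norm_pow_stdGaussian)

namespace Summit.AtomisticToContinuum.HydrodynamicLimit.Cruxes.CellForecastPressureDecay.Disproof

noncomputable section

/-! ## § 1 Frame: the cell Gibbs law is a probability measure -/

/-- The confining cube `[0,L]^3` of the crux. -/
def cellCube (L : ℝ) : Set V3 := {x : V3 | ∀ k, x k ∈ Set.Icc (0 : ℝ) L}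

/-- The one-particle reference density of the crux: `1_{[0,L]^3}(x) · M(v)`. -/
def cellRef (L : ℝ) (p : V3 × V3) : ℝ :=
  Set.indicator {x : V3 | ∀ k, x k ∈ Set.Icc (0 : ℝ) L} (fun _ => (1 : ℝ)) p.1 * globalMaxwellian p.2

theorem cellRef_eq (L : ℝ) : cellRef L = fun p : V3 × V3 =>
    Set.indicator {x : V3 | ∀ k, x k ∈ Set.Icc (0 : ℝ) L} (fun _ => (1 : ℝ)) p.1 *
      globalMaxwellian p.2 := rfl

theorem cellCube_eq_preimage (L : ℝ) :
    cellCube L = (WithLp.ofLp : V3 → (Fin 3 → ℝ)) ⁻¹' Set.Icc (0 : Fin 3 → ℝ) (fun _ => L) := by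
  ext x
  simp only [cellCube, mem_setOf_eq, mem_Icc, mem_preimage, Pi.le_def, Pi.zero_apply]
  exact ⟨fun h => ⟨fun k => (h k).1, fun k => (h k).2⟩, fun h k => ⟨h.1 k, h.2 k⟩⟩

theorem measurableSet_cellCube (L : ℝ) : MeasurableSet (cellCube L) := by
  rw [cellCube_eq_preimage]
  exact measurableSet_Icc.preimage (PiLp.volume_preserving_ofLp (Fin 3)).measurable

theorem volume_cellCube (L : ℝ) : volume (cellCube L) = ENNReal.ofReal L ^ 3 := by
  rw [cellCube_eq_preimage, (PiLp.volume_preserving_ofLp (Fin 3)).measure_preimage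
      measurableSet_Icc.nullMeasurableSet, Real.volume_Icc_pi]
  simp

theorem cellRef_nonneg (L : ℝ) : 0 ≤ cellRef L := fun p =>
  mul_nonneg (Set.indicator_nonneg (fun _ _ => zero_le_one) _) (globalMaxwellian_pos p.2).le

theorem integrable_cellRef (L : ℝ) : Integrable (cellRef L) := by
  have h1 : Integrable (fun x : V3 => (cellCube L).indicator (fun _ => (1 : ℝ)) x) := by
    rw [integrable_indicator_iff (measurableSet_cellCube L)]
    refine integrableOn_const ?_
    rw [volume_cellCube]
    exact (ENNReal.pow_lt_top ENNReal.ofReal_lt_top).ne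
  have h2 : Integrable (globalMaxwellian (E := V3)) := integrable_globalMaxwellian
  have h := h1.mul_prod h2
  rw [← Measure.volume_eq_prod] at h
  exact h

/-- A grid of `n ≤ 2L³` well-separated points inside `[1/8, L - 1/8]^3` (spacing `1/4`). -/
theorem exists_grid {L : ℝ} (hL : 1 ≤ L) {n : ℕ} (hn : (n : ℝ) ≤ 2 * L ^ 3) :
    ∃ c : Fin n → V3, (∀ i k, 1 / 8 ≤ c i k ∧ c i k ≤ L - 1 / 8) ∧
      ∀ i j, i ≠ j → ∃ k, 1 / 4 ≤ |c i k - c j k| := by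
  set m := ⌊L⌋₊ with hm
  have hm1 : 1 ≤ m := Nat.le_floor (by exact_mod_cast hL)
  have hm1' : (1 : ℝ) ≤ m := by exact_mod_cast hm1
  have hLm : L < m + 1 := Nat.lt_floor_add_one L
  have hmL : (m : ℝ) ≤ L := Nat.floor_le (by linarith)
  set M := 4 * m with hM
  have hcard : n ≤ Fintype.card (Fin 3 → Fin M) := by
    classical
    rw [Fintype.card_fun, Fintype.card_fin, Fintype.card_fin]
    have h0 : (0 : ℝ) ≤ L := by linarith
    have : (n : ℝ) < (M : ℝ) ^ 3 := by
      calc (n : ℝ) ≤ 2 * L ^ 3 := hn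
        _ < 2 * ((m : ℝ) + 1) ^ 3 := by gcongr
        _ ≤ 2 * (2 * (m : ℝ)) ^ 3 := by gcongr; linarith
        _ = 16 * (m : ℝ) ^ 3 := by ring
        _ ≤ 64 * (m : ℝ) ^ 3 := by nlinarith [pow_nonneg (zero_le_one.trans hm1') 3]
        _ = (M : ℝ) ^ 3 := by rw [hM]; push_cast; ring
    exact_mod_cast this.le
  let ι : Fin n → (Fin 3 → Fin M) := fun i =>
    (Fintype.equivFin (Fin 3 → Fin M)).symm (Fin.castLE hcard i)
  have hι : Function.Injective ι :=
    (Equiv.injective _).comp (Fin.castLE_injective hcard)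
  refine ⟨fun i => WithLp.toLp 2 fun k => ((ι i k : ℕ) : ℝ) / 4 + 1 / 8, ?_, ?_⟩
  · intro i k
    dsimp only
    have hq : ((ι i k : ℕ) : ℝ) + 1 ≤ M := by exact_mod_cast (ι i k).isLt
    have hq0 : (0 : ℝ) ≤ ((ι i k : ℕ) : ℝ) := Nat.cast_nonneg _
    have hM' : (M : ℝ) = 4 * m := by rw [hM]; push_cast; ring
    constructor
    · linarith
    · rw [hM'] at hq
      linarith
  · intro i j hij
    have hne : ι i ≠ ι j := fun h => hij (hι h)
    obtain ⟨k, hk⟩ := Function.ne_iff.1 hne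
    refine ⟨k, ?_⟩
    dsimp only
    have hk' : (ι i k : ℕ) ≠ (ι j k : ℕ) := fun h => hk (Fin.ext h)
    have h1 : (1 : ℝ) ≤ |((ι i k : ℕ) : ℝ) - ((ι j k : ℕ) : ℝ)| := by
      rcases lt_or_gt_of_ne hk' with h | h
      · have : ((ι i k : ℕ) : ℝ) + 1 ≤ ((ι j k : ℕ) : ℝ) := by exact_mod_cast h
        rw [abs_sub_comm, abs_of_nonneg (by linarith)]
        linarith
      · have : ((ι j k : ℕ) : ℝ) + 1 ≤ ((ι i k : ℕ) : ℝ) := by exact_mod_cast h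
        rw [abs_of_nonneg (by linarith)]
        linarith
    have : ((ι i k : ℕ) : ℝ) / 4 + 1 / 8 - (((ι j k : ℕ) : ℝ) / 4 + 1 / 8) =
        (((ι i k : ℕ) : ℝ) - ((ι j k : ℕ) : ℝ)) / 4 := by ring
    rw [this, abs_div, abs_of_pos (by norm_num : (0 : ℝ) < 4)]
    linarith

/-- Coordinates are `1`-Lipschitz on `V3 = ℝ³` (Euclidean norm). -/
theorem abs_apply_sub_apply_le (x y : V3) (k : Fin 3) : |x k - y k| ≤ ‖x - y‖ := by
  have h := PiLp.norm_apply_le (x - y) k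
  rwa [PiLp.sub_apply, Real.norm_eq_abs] at h

/-- **Positivity of the cell partition function**: for `0 ≤ σ ≤ 3/16`, `L ≥ 1` and `n ≤ 2L³`
the canonical partition function of `n` spheres of diameter `σ` in `[0,L]^3` with Maxwellian
velocities is positive (explicit grid of admissible configurations). -/
theorem canonicalPartition_cell_pos {σ L : ℝ} (hσ' : σ ≤ 3 / 16) (hL : 1 ≤ L)
    {n : ℕ} (hn : (n : ℝ) ≤ 2 * L ^ 3) :
    0 < canonicalPartition (Euclidean.geometry (Fin 3)) σ n (cellRef L) := by
  obtain ⟨c, hc_in, hc_sep⟩ := exists_grid hL hn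
  set A : Set (Config n (Fin 3) V3) :=
    Set.univ.pi fun i => ball (c i) (1 / 32) ×ˢ ball (0 : V3) 1 with hA
  have hAm : MeasurableSet A :=
    MeasurableSet.univ_pi fun i => measurableSet_ball.prod measurableSet_ball
  have hvolA : volume A =
      ∏ i : Fin n, volume (ball (c i) (1 / 32 : ℝ)) * volume (ball (0 : V3) (1 : ℝ)) := by
    rw [hA, volume_pi, Measure.pi_pi]
    congr 1
    funext i
    rw [Measure.volume_eq_prod, Measure.prod_prod]
  have hvolA_pos : 0 < volume A := by
    rw [hvolA]
    exact pos_iff_ne_zero.2 (Finset.prod_ne_zero_iff.2 fun i _ =>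
      mul_ne_zero (measure_ball_pos volume _ (by norm_num)).ne' (measure_ball_pos volume _ one_pos).ne')
  have hvolA_lt : volume A < ⊤ := by
    rw [hvolA]
    exact ENNReal.prod_lt_top fun i _ => ENNReal.mul_lt_top measure_ball_lt_top measure_ball_lt_top
  -- Maxwellian floor on the unit ball
  set e : V3 := EuclideanSpace.single 0 1 with he
  set μ₀ : ℝ := globalMaxwellian e with hμ₀def
  have hμ₀ : 0 < μ₀ := globalMaxwellian_pos e
  have hfloor : ∀ v : V3, ‖v‖ < 1 → μ₀ ≤ globalMaxwellian v := by
    intro v hv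
    have hne : ‖e‖ = 1 := by
      rw [he, EuclideanSpace.single, PiLp.norm_single, norm_one]
    simp only [hμ₀def, globalMaxwellian]
    refine mul_le_mul_of_nonneg_left (Real.exp_le_exp.2 ?_) (by positivity)
    rw [hne]
    have : ‖v‖ ^ 2 ≤ 1 := by nlinarith [norm_nonneg v]
    linarith
  -- pointwise lower bound
  have hpt : ∀ z, A.indicator (fun _ => μ₀ ^ n) z ≤
      (hardSphereDomain (Euclidean.geometry (Fin 3)) n σ).indicator (tensorPow n (cellRef L)) z := by
    intro z
    by_cases hz : z ∈ A
    · have hz' : ∀ i, dist (z i).1 (c i) < 1 / 32 ∧ ‖(z i).2‖ < 1 := by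
        intro i
        have := (Set.mem_univ_pi.1 hz) i
        rw [Set.mem_prod, mem_ball, mem_ball_zero_iff] at this
        exact this
      have hcoord : ∀ i k, |(z i).1 k - c i k| < 1 / 32 := fun i k =>
        (abs_apply_sub_apply_le _ _ k).trans_lt (by rw [← dist_eq_norm]; exact (hz' i).1)
      have hzD : z ∈ hardSphereDomain (Euclidean.geometry (Fin 3)) n σ := by
        rw [mem_hardSphereDomain]
        intro i j hij
        obtain ⟨k, hk⟩ := hc_sep i j hij
        rw [Euclidean.geometry_sepVec]
        have h1 := hcoord i k
        have h2 := hcoord j k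
        have h3 := abs_apply_sub_apply_le (z i).1 (z j).1 k
        have h4 : 3 / 16 ≤ |(z i).1 k - (z j).1 k| := by
          have := abs_sub_abs_le_abs_sub (c i k - c j k) ((c i k - (z i).1 k) - (c j k - (z j).1 k))
          have h5 : c i k - c j k - (c i k - (z i).1 k - (c j k - (z j).1 k)) = (z i).1 k - (z j).1 k := by ring
          rw [h5] at this
          have h6 := abs_sub (c i k - (z i).1 k) (c j k - (z j).1 k)
          rw [abs_sub_comm (c i k)] at h6
          rw [abs_sub_comm (c j k)] at h6
          linarith
        linarith
      rw [indicator_of_mem hz, indicator_of_mem hzD, tensorPow]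
      have hfac : ∀ i, μ₀ ≤ cellRef L (z i) := by
        intro i
        have hxin : (z i).1 ∈ {x : V3 | ∀ k, x k ∈ Set.Icc (0 : ℝ) L} := by
          intro k
          have h1 := hcoord i k
          have h2 := hc_in i k
          rw [abs_lt] at h1
          constructor <;> linarith [h2.1, h2.2]
        simp only [cellRef, indicator_of_mem hxin, one_mul]
        exact hfloor _ (hz' i).2
      calc μ₀ ^ n = ∏ _i : Fin n, μ₀ := by simp
        _ ≤ ∏ i, cellRef L (z i) := Finset.prod_le_prod (fun i _ => hμ₀.le) fun i _ => hfac i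
    · rw [indicator_of_notMem hz]
      exact Set.indicator_nonneg (fun w _ => tensorPow_nonneg (cellRef_nonneg L) n w) _
  have hint : Integrable ((hardSphereDomain (Euclidean.geometry (Fin 3)) n σ).indicator
      (tensorPow n (cellRef L))) :=
    (integrable_tensorPow n (integrable_cellRef L)).indicator
      (measurableSet_hardSphereDomain _ Euclidean.measurable_geometry_sepVec n σ)
  have hintA : Integrable (A.indicator fun _ : Config n (Fin 3) V3 => μ₀ ^ n) := by
    rw [integrable_indicator_iff hAm]
    exact integrableOn_const hvolA_lt.ne
  calc 0 < (volume A).toReal * μ₀ ^ n :=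
        mul_pos (ENNReal.toReal_pos hvolA_pos.ne' hvolA_lt.ne) (pow_pos hμ₀ n)
    _ = ∫ z, A.indicator (fun _ => μ₀ ^ n) z := by
        rw [integral_indicator_const _ hAm, smul_eq_mul, Measure.real]
    _ ≤ canonicalPartition (Euclidean.geometry (Fin 3)) σ n (cellRef L) :=
        integral_mono hintA hint hpt

/-- **The cell Gibbs law of the crux is a probability measure** for `0 ≤ σ ≤ 3/16`, `L ≥ 1`,
`n ≤ 2L³`, whatever the hard-sphere flow parameter. -/
theorem isProbabilityMeasure_cellLaw {σ L : ℝ} (hσ' : σ ≤ 3 / 16) (hL : 1 ≤ L)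
    {n : ℕ} (hn : (n : ℝ) ≤ 2 * L ^ 3) (Φ : HardSphereFlow (Euclidean.geometry (Fin 3)) σ n) :
    IsProbabilityMeasure (particleLaw Φ
      (canonicalDensity (Euclidean.geometry (Fin 3)) σ n (cellRef L))) := by
  have hZ := canonicalPartition_cell_pos hσ' hL hn
  refine isProbabilityMeasure_particleLaw Φ ?_ ?_ (integral_canonicalDensity _ _ _ _ hZ.ne')
  · intro z
    simp only [canonicalDensity, Pi.zero_apply]
    exact mul_nonneg (inv_nonneg.2 hZ.le)
      (Set.indicator_nonneg (fun w _ => tensorPow_nonneg (cellRef_nonneg L) n w) z)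
  · intro z hz
    simp only [canonicalDensity]
    rw [indicator_of_notMem hz, mul_zero]

/-! ## § 2 Load-bearing hypothesis: orthogonality `g ⊥ span(1, v, |v|²)` -/

/-- `CellForecastPressureDecay` with the orthogonality hypothesis
`∀ c₀ c₂ b, ∫ g · (c₀ + ⟪b, v⟫ + c₂‖v‖²) dγ = 0` DROPPED (everything else byte-identical). -/
def CellForecastPressureDecayWithoutOrthogonality : Prop :=
  ∃ σ₀ : ℝ, 0 < σ₀ ∧ ∀ σ : ℝ, 0 < σ → σ < σ₀ → ∃ κ : ℝ, 0 < κ ∧ ∀ g : Literature.MathematicalPhysics.KineticTheory.V3 → ℝ, Continuous g → (∀ v, |g v| ≤ κ) → ∀ δ : ℝ, 0 < δ → ∃ T : ℝ, 0 < T ∧ ∃ R₀ : ℝ, 0 < R₀ ∧ ∀ R : ℝ, R₀ ≤ R → ∃ L₀ : ℝ, 0 < L₀ ∧ ∀ L : ℝ, L₀ ≤ L → ∀ n : ℕ, (n : ℝ) ≤ 2 * L ^ 3 → ∀ (Ψ : (k : ℕ) → Literature.Analysis.FluidPDE.HardSphereFlow (Literature.Analysis.FluidPDE.Euclidean.geometry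 (Fin 3)) σ k) (c : ℝ), |c| ≤ 1 → ∫⁻ z, ENNReal.ofReal (Real.exp (2 * c * ∑ i : Fin n, T⁻¹ * ∫ t in (0 : ℝ)..T, g (Literature.Analysis.FluidPDE.localClusterState Ψ R t z i).2)) ∂(Literature.Analysis.FluidPDE.particleLaw (Ψ n) (Literature.Analysis.FluidPDE.canonicalDensity (Literature.Analysis.FluidPDE.Euclidean.geometry (Fin 3)) σ n (fun p => Set.indicator {x : Literature.MathematicalPhysics.KineticTheory.V3 | ∀ k, x k ∈ Set.Icc (0 : ℝ) L} (fun _ => (1 : ℝ)) p.1 * Literature.Analysis.FluidPDE.globalMaxwellian p.2))) ≤ ENNReal.ofReal (Real.exp (δ * L ^ 3))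

/-- Sanity check: the variant is the crux with one hypothesis fewer (so it implies the crux). -/
theorem cellForecastPressureDecay_of_withoutOrthogonality
    (h : CellForecastPressureDecayWithoutOrthogonality) :
    Summit.AtomisticToContinuum.HydrodynamicLimit.Theses.AntiMazurCoboundaries.CellForecastPressureDecay := by
  obtain ⟨σ₀, hσ₀, h⟩ := h
  refine ⟨σ₀, hσ₀, fun σ hσ hσ' => ?_⟩
  obtain ⟨κ, hκ, h⟩ := h σ hσ hσ'
  exact ⟨κ, hκ, fun g hg hgb _ => h g hg hgb⟩

/-- **Any proof must use the orthogonality of `g` to the constants**: with `g ≡ κ` (continuous,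
`|g| ≤ κ`, but `∫ g dγ = κ ≠ 0`) the time average of `g` along ANY forecast is `κ`, the integrand
is the constant `exp(2cnκ)`, the cell law is a probability measure, and for `n = ⌊L³⌋`, `c = 1`,
`δ = κ` the bound `exp(2nκ) ≤ exp(κL³)` fails. No dynamics is used. -/
theorem cellForecastPressureDecay_false_without_orthogonality :
    ¬ CellForecastPressureDecayWithoutOrthogonality := by
  rintro ⟨σ₀, hσ₀, h⟩
  set σ : ℝ := min (σ₀ / 2) (3 / 16) with hσdef
  have hσpos : 0 < σ := by positivity
  have hσlt : σ < σ₀ := (min_le_left _ _).trans_lt (by linarith)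
  obtain ⟨κ, hκ, h⟩ := h σ hσpos hσlt
  obtain ⟨T, hT, R₀, hR₀, h⟩ :=
    h (fun _ => κ) continuous_const (fun v => by rw [abs_of_pos hκ]) κ hκ
  obtain ⟨L₀, hL₀, h⟩ := h R₀ le_rfl
  set L : ℝ := max L₀ 2 with hLdef
  have hL2 : 2 ≤ L := le_max_right _ _
  set n : ℕ := ⌊L ^ 3⌋₊ with hndef
  have hnle : (n : ℝ) ≤ L ^ 3 := Nat.floor_le (by positivity)
  have hnlt : L ^ 3 < n + 1 := Nat.lt_floor_add_one _
  set Ψ : (k : ℕ) → HardSphereFlow (Euclidean.geometry (Fin 3)) σ k :=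
    fun k => (HardSphereFlow.nonempty_holds hσpos k).some with hΨ
  have key := h L (le_max_left _ _) n (by linarith [pow_nonneg (by linarith : (0:ℝ) ≤ L) 3]) Ψ 1
    (by simp)
  have hP : IsProbabilityMeasure (particleLaw (Ψ n) (canonicalDensity
      (Euclidean.geometry (Fin 3)) σ n (fun p : V3 × V3 =>
        Set.indicator {x : V3 | ∀ k, x k ∈ Set.Icc (0 : ℝ) L} (fun _ => (1 : ℝ)) p.1 *
          globalMaxwellian p.2))) :=
    isProbabilityMeasure_cellLaw (min_le_right _ _) (by linarith)
      (by linarith [pow_nonneg (by linarith : (0:ℝ) ≤ L) 3]) (Ψ n)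
  simp only [intervalIntegral.integral_const, sub_zero, smul_eq_mul, Finset.sum_const,
    Finset.card_univ, Fintype.card_fin, nsmul_eq_mul, lintegral_const, measure_univ,
    mul_one] at key
  rw [ENNReal.ofReal_le_ofReal_iff (by positivity), Real.exp_le_exp] at key
  -- key : 2 * 1 * (n * (T⁻¹ * (T * κ))) ≤ κ * L ^ 3
  rw [inv_mul_cancel_left₀ hT.ne'] at key
  have h8 : (8 : ℝ) ≤ L ^ 3 := by
    have h4 : (4 : ℝ) ≤ L ^ 2 := by nlinarith
    nlinarith
  nlinarith [mul_pos hκ (by linarith : (0:ℝ) < 2 * n - L ^ 3)]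

/-! ## § 3 A lone particle: a 1-cluster forecast is free flight -/

section LoneParticle

variable {d : Type*} [Fintype d] {X : Type*} [MeasureSpace X] [TopologicalSpace X]
  {G : Geometry d X} {ε : ℝ}

/-- A hard-sphere trajectory of at most one particle keeps its velocities (there is no pair, hence
no collision time, hence free flight by the `free` field). -/
theorem vel_flow_eq_of_le_one {k : ℕ} (hk : k ≤ 1) (Φ : HardSphereFlow G ε k) {z : Config k d X}
    (hz : z ∈ Φ.good) (t : ℝ) (m : Fin k) : (Φ.flow t z m).2 = (z m).2 := by
  have htraj := Φ.isTrajectory z hz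
  have hno : ∀ τ, τ ∉ collisionTimes G ε (fun s => Φ.flow s z) := by
    intro τ hτ
    obtain ⟨i, j, hij, -⟩ := mem_collisionTimes.1 hτ
    have hi := i.isLt
    have hj := j.isLt
    exact hij (Fin.ext (by omega))
  rcases le_total 0 t with ht | ht
  · have h := congrFun (htraj.free 0 t ht fun τ _ => hno τ) m
    rw [h, freeFlight_apply, Φ.flow_zero z hz]
  · have h := congrFun (htraj.free t 0 ht fun τ _ => hno τ) m
    rw [Φ.flow_zero z hz] at h
    rw [h, freeFlight_apply]

variable {N : ℕ}

/-- The isolated evolution of a cluster with at most one particle does not change velocities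
(on and off the good set: off it the cluster is frozen). -/
theorem vel_clusterStateIn_of_card_le_one (Ψ : (k : ℕ) → HardSphereFlow G ε k) {S : Finset (Fin N)}
    (hS : S.card ≤ 1) (m : Fin S.card) (t : ℝ) (z : Config N d X) :
    (clusterStateIn Ψ S m t z).2 = (Config.restrictTo S z m).2 := by
  by_cases hz : Config.restrictTo S z ∈ (Ψ S.card).good
  · rw [clusterStateIn_of_mem_good Ψ m t hz]
    exact vel_flow_eq_of_le_one hS (Ψ S.card) hz t m
  · rw [clusterStateIn_of_not_mem_good Ψ m t hz, Config.restrictTo_apply]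

/-- **A lone particle flies freely**: if the range cluster of `i` is `{i}`, the forecast velocity of
`i` is its initial velocity at all times. -/
theorem vel_localClusterState_of_card_le_one (Ψ : (k : ℕ) → HardSphereFlow G ε k) {R : ℝ}
    {z : Config N d X} {i : Fin N} (h : (rangeCluster G R z i).card ≤ 1) (t : ℝ) :
    (localClusterState Ψ R t z i).2 = (z i).2 := by
  rw [localClusterState, vel_clusterStateIn_of_card_le_one Ψ h, Config.restrictTo_clusterIndex]

end LoneParticle

/-- For `n = 1` the crux's window average is `g(v)`: the single particle is its own cluster. -/
theorem windowAverage_one {σ : ℝ} (Ψ : (k : ℕ) → HardSphereFlow (Euclidean.geometry (Fin 3)) σ k)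
    (R : ℝ) {T : ℝ} (hT : T ≠ 0) (g : V3 → ℝ) (c : ℝ) (z : Config 1 (Fin 3) V3) :
    2 * c * ∑ i : Fin 1, T⁻¹ * ∫ t in (0 : ℝ)..T, g (localClusterState Ψ R t z i).2 =
      2 * c * g (z 0).2 := by
  have hcard : ∀ i : Fin 1, (rangeCluster (Euclidean.geometry (Fin 3)) R z i).card ≤ 1 :=
    fun i => (Finset.card_le_univ _).trans (by simp)
  simp only [vel_localClusterState_of_card_le_one Ψ (hcard _), intervalIntegral.integral_const,
    sub_zero, smul_eq_mul, Fin.sum_univ_one, inv_mul_cancel_left₀ hT]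

/-! ## § 4 The one-particle cell law and its exponential moments -/

/-- One particle: the hard-sphere domain is everything. -/
theorem hardSphereDomain_one (σ : ℝ) :
    hardSphereDomain (Euclidean.geometry (Fin 3)) 1 σ = (univ : Set (Config 1 (Fin 3) V3)) :=
  eq_univ_of_forall fun _ => mem_hardSphereDomain.2 fun i j hij => absurd (Subsingleton.elim i j) hij

/-- `cellRef L` is measurable. -/
theorem measurable_cellRef (L : ℝ) : Measurable (cellRef L) :=
  ((measurable_const.indicator (measurableSet_cellCube L)).comp measurable_fst).mul
    (continuous_globalMaxwellian.measurable.comp measurable_snd)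

/-- `∫ cellRef L = L³`. -/
theorem integral_cellRef {L : ℝ} (hL : 0 ≤ L) : ∫ p : V3 × V3, cellRef L p = L ^ 3 := by
  have h3 : ∫ p : V3 × V3, cellRef L p =
      (∫ x : V3, (cellCube L).indicator (fun _ => (1 : ℝ)) x) * ∫ v : V3, globalMaxwellian v := by
    rw [Measure.volume_eq_prod, ← integral_prod_mul]
    rfl
  rw [h3, integral_indicator_const _ (measurableSet_cellCube L), smul_eq_mul, mul_one, Measure.real,
    volume_cellCube, show (∫ v : V3, globalMaxwellian v) = 1 from integral_globalMaxwellian_eq_one_holds,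
    mul_one, ← ENNReal.ofReal_pow hL, ENNReal.toReal_ofReal (pow_nonneg hL 3)]

/-- One particle: the partition function is `L³`. -/
theorem canonicalPartition_one (σ : ℝ) {L : ℝ} (hL : 0 ≤ L) :
    canonicalPartition (Euclidean.geometry (Fin 3)) σ 1 (cellRef L) = L ^ 3 := by
  rw [canonicalPartition, hardSphereDomain_one, indicator_univ]
  have h1 : (tensorPow 1 (cellRef L) : Config 1 (Fin 3) V3 → ℝ) =
      fun z : Config 1 (Fin 3) V3 => cellRef L (z 0) := by
    funext z
    simp [tensorPow]
  rw [h1, ← integral_cellRef hL,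
    ← (volume_preserving_funUnique (Fin 1) (V3 × V3)).integral_comp' (cellRef L)]
  rfl

/-- One particle: the cell law is Lebesgue measure with density `L⁻³ 1_{[0,L]³}(x) M(v)`. -/
theorem cellLaw_one_eq (σ : ℝ) {L : ℝ} (hL : 0 < L)
    (Φ : HardSphereFlow (Euclidean.geometry (Fin 3)) σ 1) :
    particleLaw Φ (canonicalDensity (Euclidean.geometry (Fin 3)) σ 1 (cellRef L)) =
      volume.withDensity
        (fun z : Config 1 (Fin 3) V3 => ENNReal.ofReal ((L ^ 3)⁻¹ * cellRef L (z 0))) := by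
  rw [particleLaw_eq, liouville_eq, hardSphereDomain_one, Measure.restrict_univ]
  congr 1
  funext z
  rw [canonicalDensity, canonicalPartition_one σ hL.le, hardSphereDomain_one, indicator_univ]
  simp [tensorPow]

/-- **Exponential moments of the one-particle cell law**: for measurable `F ≥ 0` with `M·F`
integrable, `∫⁻ F(v) dP_{1,L} = ∫ M F dv` — the position is uniform on the cube and integrates out. -/
theorem lintegral_cellLaw_one (σ : ℝ) {L : ℝ} (hL : 0 < L)
    (Φ : HardSphereFlow (Euclidean.geometry (Fin 3)) σ 1) {F : V3 → ℝ} (hFm : Measurable F)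
    (hF0 : ∀ v, 0 ≤ F v) (hFi : Integrable fun v => globalMaxwellian v * F v) :
    ∫⁻ z, ENNReal.ofReal (F (z 0).2)
        ∂(particleLaw Φ (canonicalDensity (Euclidean.geometry (Fin 3)) σ 1 (cellRef L))) =
      ENNReal.ofReal (∫ v, globalMaxwellian v * F v) := by
  have hL3 : 0 < L ^ 3 := pow_pos hL 3
  have hdens : Measurable fun z : Config 1 (Fin 3) V3 =>
      ENNReal.ofReal ((L ^ 3)⁻¹ * cellRef L (z 0)) :=
    (((measurable_cellRef L).comp (measurable_pi_apply 0)).const_mul _).ennreal_ofReal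
  have hFz : Measurable fun z : Config 1 (Fin 3) V3 => ENNReal.ofReal (F (z 0).2) :=
    (hFm.comp ((measurable_pi_apply 0).snd)).ennreal_ofReal
  rw [cellLaw_one_eq σ hL Φ, lintegral_withDensity_eq_lintegral_mul _ hdens hFz]
  -- transport `Config 1 ≃ V3 × V3`
  have hmp := volume_preserving_funUnique (Fin 1) (V3 × V3)
  have step1 : ∫⁻ z : Config 1 (Fin 3) V3, ((fun z : Config 1 (Fin 3) V3 =>
      ENNReal.ofReal ((L ^ 3)⁻¹ * cellRef L (z 0))) * fun z : Config 1 (Fin 3) V3 =>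
        ENNReal.ofReal (F (z 0).2)) z =
      ∫⁻ p : V3 × V3, ENNReal.ofReal ((L ^ 3)⁻¹ * cellRef L p) * ENNReal.ofReal (F p.2) := by
    rw [← hmp.lintegral_comp_emb (MeasurableEquiv.measurableEmbedding _)]
    rfl
  rw [step1]
  -- split the integrand as (function of x) * (function of v)
  have step2 : ∀ p : V3 × V3, ENNReal.ofReal ((L ^ 3)⁻¹ * cellRef L p) * ENNReal.ofReal (F p.2) =
      (cellCube L).indicator (fun _ => (1 : ℝ≥0∞)) p.1 *
        ENNReal.ofReal ((L ^ 3)⁻¹ * (globalMaxwellian p.2 * F p.2)) := by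
    rintro ⟨x, v⟩
    by_cases hx : x ∈ cellCube L
    · simp only [cellRef, cellCube] at hx ⊢
      rw [indicator_of_mem hx, indicator_of_mem hx, one_mul, one_mul,
        ← ENNReal.ofReal_mul (mul_nonneg (inv_nonneg.2 hL3.le) (globalMaxwellian_pos _).le)]
      ring_nf
    · simp only [cellRef, cellCube] at hx ⊢
      rw [indicator_of_notMem hx, indicator_of_notMem hx]
      simp
  simp_rw [step2]
  have hf1 : Measurable fun x : V3 => (cellCube L).indicator (fun _ => (1 : ℝ≥0∞)) x :=
    measurable_const.indicator (measurableSet_cellCube L)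
  have hf2 : Measurable fun v : V3 => ENNReal.ofReal ((L ^ 3)⁻¹ * (globalMaxwellian v * F v)) :=
    ((continuous_globalMaxwellian.measurable.mul hFm).const_mul _).ennreal_ofReal
  rw [Measure.volume_eq_prod, lintegral_prod_mul hf1.aemeasurable hf2.aemeasurable,
    lintegral_indicator_const (measurableSet_cellCube L), one_mul, volume_cellCube,
    ← ofReal_integral_eq_lintegral_ofReal (hFi.const_mul _)
      (Eventually.of_forall fun v => by
        exact mul_nonneg (inv_nonneg.2 hL3.le) (mul_nonneg (globalMaxwellian_pos v).le (hF0 v))),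
    integral_const_mul, ← ENNReal.ofReal_pow hL.le, ← ENNReal.ofReal_mul (by positivity),
    ← mul_assoc, mul_inv_cancel₀ hL3.ne', one_mul]

/-! ## § 5 A certified admissible observable: `g(v) = κ sin v₀ sin v₁` -/

/-- The witness observable `g_κ(v) = κ sin(v₀) sin(v₁)`. -/
def gW (κ : ℝ) (v : V3) : ℝ := κ * (Real.sin (v 0) * Real.sin (v 1))

theorem continuous_gW (κ : ℝ) : Continuous (gW κ) := by
  unfold gW
  fun_prop

theorem abs_sin_mul_sin_le_one (v : V3) : |Real.sin (v 0)| * |Real.sin (v 1)| ≤ 1 := by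
  have h := mul_le_mul (Real.abs_sin_le_one (v 0)) (Real.abs_sin_le_one (v 1)) (abs_nonneg _)
    zero_le_one
  rwa [one_mul] at h

theorem abs_gW_le_abs (κ : ℝ) (v : V3) : |gW κ v| ≤ |κ| := by
  rw [gW, abs_mul, abs_mul]
  have h := mul_le_mul_of_nonneg_left (abs_sin_mul_sin_le_one v) (abs_nonneg κ)
  rwa [mul_one] at h

theorem abs_gW_le {κ : ℝ} (hκ : 0 ≤ κ) (v : V3) : |gW κ v| ≤ κ := by
  have h := abs_gW_le_abs κ v
  rwa [abs_of_nonneg hκ] at h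

/-- The standard orthonormal basis of `V3`. -/
abbrev bV : OrthonormalBasis (Fin 3) ℝ V3 := EuclideanSpace.basisFun (Fin 3) ℝ

theorem inner_bV (m : Fin 3) (v : V3) : ⟪bV m, v⟫_ℝ = v m := by
  simp [EuclideanSpace.basisFun_apply, EuclideanSpace.inner_single_left]

/-- Coordinates after the coordinate reflection `R_i` (reflection in `(e_i)ᗮ`). -/
theorem reflect_apply (i m : Fin 3) (v : V3) :
    ((ℝ ∙ bV i)ᗮ.reflection v) m = if m = i then -v m else v m := by
  rw [← inner_bV, inner_basis_reflection_flip bV i m v, inner_bV]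

theorem gW_reflect0 (κ : ℝ) (v : V3) : gW κ ((ℝ ∙ bV 0)ᗮ.reflection v) = -gW κ v := by
  simp only [gW, reflect_apply, if_true, show (1 : Fin 3) ≠ 0 by decide, if_false, Real.sin_neg]
  ring

theorem gW_reflect1 (κ : ℝ) (v : V3) : gW κ ((ℝ ∙ bV 1)ᗮ.reflection v) = -gW κ v := by
  simp only [gW, reflect_apply, if_true, show (0 : Fin 3) ≠ 1 by decide, if_false, Real.sin_neg]
  ring

/-- **Admissibility**: `g_κ ⊥ span(1, v, |v|²)` in `L²(stdGaussian)` (coordinate reflections: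
`g_κ` is odd in `v₀` and odd in `v₁`). -/
theorem gW_orthogonal (κ : ℝ) (c₀ c₂ : ℝ) (b : V3) :
    ∫ v, gW κ v * (c₀ + inner ℝ b v + c₂ * ‖v‖ ^ 2) ∂stdGaussian V3 = 0 := by
  -- expand ⟪b, v⟫ in coordinates
  have hinner : ∀ v : V3, inner ℝ b v = b 0 * v 0 + b 1 * v 1 + b 2 * v 2 := by
    intro v
    rw [← bV.sum_inner_mul_inner b v, Fin.sum_univ_three]
    simp only [inner_bV]
    have : ∀ m, ⟪b, bV m⟫_ℝ = b m := fun m => by rw [real_inner_comm, inner_bV]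
    simp only [this]
  set G₁ : V3 → ℝ := fun v => gW κ v * (c₀ + b 1 * v 1 + b 2 * v 2 + c₂ * ‖v‖ ^ 2) with hG₁
  set G₂ : V3 → ℝ := fun v => gW κ v * (b 0 * v 0) with hG₂
  have hsplit : (fun v => gW κ v * (c₀ + inner ℝ b v + c₂ * ‖v‖ ^ 2)) = fun v => G₁ v + G₂ v := by
    funext v
    simp only [hG₁, hG₂, hinner]
    ring
  -- integrability (bounded × quadratic growth under the Gaussian)
  have hbound : ∀ (C : ℝ), 0 ≤ C → ∀ (H : V3 → ℝ), Continuous H →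
      (∀ v, |H v| ≤ C * (1 + ‖v‖) ^ 2) → Integrable H (stdGaussian V3) := by
    intro C hC H hH hle
    refine Integrable.mono' ((integrable_one_add_norm_pow_stdGaussian 2).const_mul C)
      hH.aestronglyMeasurable (Eventually.of_forall fun v => ?_)
    rw [Real.norm_eq_abs]
    exact hle v
  have hκ' : ∀ v, |gW κ v| ≤ |κ| := abs_gW_le_abs κ
  have hcoord : ∀ (v : V3) (m : Fin 3), |v m| ≤ ‖v‖ := fun v m => by
    simpa using PiLp.norm_apply_le v m
  have hI₁ : Integrable G₁ (stdGaussian V3) := by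
    refine hbound (|κ| * (|c₀| + |b 1| + |b 2| + |c₂|)) (by positivity) G₁
      (by simp only [hG₁]; exact (continuous_gW κ).mul (by fun_prop)) fun v => ?_
    simp only [hG₁]
    rw [abs_mul]
    have h1 := hκ' v
    have h2 := hcoord v 1
    have h3 := hcoord v 2
    have hn := norm_nonneg v
    have : |c₀ + b 1 * v 1 + b 2 * v 2 + c₂ * ‖v‖ ^ 2| ≤ (|c₀| + |b 1| + |b 2| + |c₂|) * (1 + ‖v‖) ^ 2 := by
      calc |c₀ + b 1 * v 1 + b 2 * v 2 + c₂ * ‖v‖ ^ 2|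
          ≤ |c₀| + |b 1| * |v 1| + |b 2| * |v 2| + |c₂| * ‖v‖ ^ 2 := by
            have t1 := abs_add_le (c₀ + b 1 * v 1 + b 2 * v 2) (c₂ * ‖v‖ ^ 2)
            have t2 := abs_add_le (c₀ + b 1 * v 1) (b 2 * v 2)
            have t3 := abs_add_le c₀ (b 1 * v 1)
            have e1 : |b 1 * v 1| = |b 1| * |v 1| := abs_mul _ _
            have e2 : |b 2 * v 2| = |b 2| * |v 2| := abs_mul _ _
            have e3 : |c₂ * ‖v‖ ^ 2| = |c₂| * ‖v‖ ^ 2 := by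
              rw [abs_mul, abs_of_nonneg (by positivity : (0:ℝ) ≤ ‖v‖ ^ 2)]
            linarith
        _ ≤ (|c₀| + |b 1| + |b 2| + |c₂|) * (1 + ‖v‖) ^ 2 := by
            nlinarith [abs_nonneg c₀, abs_nonneg (b 1), abs_nonneg (b 2), abs_nonneg c₂,
              abs_nonneg (v 1), abs_nonneg (v 2)]
    calc |gW κ v| * |c₀ + b 1 * v 1 + b 2 * v 2 + c₂ * ‖v‖ ^ 2|
        ≤ |κ| * ((|c₀| + |b 1| + |b 2| + |c₂|) * (1 + ‖v‖) ^ 2) :=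
          mul_le_mul h1 this (abs_nonneg _) (abs_nonneg _)
      _ = |κ| * (|c₀| + |b 1| + |b 2| + |c₂|) * (1 + ‖v‖) ^ 2 := by ring
  have hI₂ : Integrable G₂ (stdGaussian V3) := by
    refine hbound (|κ| * |b 0|) (by positivity) G₂
      (by simp only [hG₂]; exact (continuous_gW κ).mul (by fun_prop)) fun v => ?_
    simp only [hG₂]
    rw [abs_mul, abs_mul]
    have h1 := hκ' v
    have h2 := hcoord v 0
    have hn := norm_nonneg v
    have hx : ‖v‖ ≤ (1 + ‖v‖) ^ 2 := by nlinarith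
    calc |gW κ v| * (|b 0| * |v 0|) ≤ |κ| * (|b 0| * ‖v‖) := by
          apply mul_le_mul h1 _ (by positivity) (abs_nonneg _)
          exact mul_le_mul_of_nonneg_left h2 (abs_nonneg _)
      _ = (|κ| * |b 0|) * ‖v‖ := by ring
      _ ≤ (|κ| * |b 0|) * (1 + ‖v‖) ^ 2 := mul_le_mul_of_nonneg_left hx (by positivity)
  -- the two odd integrals
  have h₁ : ∫ v, G₁ v ∂stdGaussian V3 = 0 := by
    refine integral_stdGaussian_eq_zero_of_odd (ℝ ∙ bV 0)ᗮ.reflection fun v => ?_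
    simp only [hG₁, gW_reflect0, reflect_apply, LinearIsometryEquiv.norm_map,
      show (1 : Fin 3) ≠ 0 by decide, show (2 : Fin 3) ≠ 0 by decide, if_false]
    ring
  have h₂ : ∫ v, G₂ v ∂stdGaussian V3 = 0 := by
    refine integral_stdGaussian_eq_zero_of_odd (ℝ ∙ bV 1)ᗮ.reflection fun v => ?_
    simp only [hG₂, gW_reflect1, reflect_apply, show (0 : Fin 3) ≠ 1 by decide, if_false]
    ring
  rw [hsplit, integral_add hI₁ hI₂, h₁, h₂, add_zero]

/-- **Strict Jensen for the witness**: `∫ e^{2 g_κ} dγ > 1` for `κ ≠ 0`. -/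
theorem one_lt_integral_exp_gW {κ : ℝ} (hκ : κ ≠ 0) :
    1 < ∫ v, Real.exp (2 * gW κ v) ∂stdGaussian V3 := by
  haveI := isOpenPosMeasure_stdGaussian (E := V3)
  have hgc : Continuous (gW κ) := continuous_gW κ
  have hb : ∀ v, |gW κ v| ≤ |κ| := abs_gW_le_abs κ
  -- integrability of the pieces (bounded continuous on a probability space)
  have hIg : Integrable (gW κ) (stdGaussian V3) :=
    (integrable_const |κ|).mono' hgc.aestronglyMeasurable
      (Eventually.of_forall fun v => by rw [Real.norm_eq_abs]; exact hb v)
  have hIe : Integrable (fun v => Real.exp (2 * gW κ v)) (stdGaussian V3) := by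
    refine (integrable_const (Real.exp (2 * |κ|))).mono' (by fun_prop) (Eventually.of_forall fun v => ?_)
    rw [Real.norm_eq_abs, abs_of_pos (Real.exp_pos _), Real.exp_le_exp]
    have := hb v
    rw [abs_le] at this
    linarith [this.2]
  set D : V3 → ℝ := fun v => Real.exp (2 * gW κ v) - (1 + 2 * gW κ v) with hD
  have hD0 : ∀ v, 0 ≤ D v := fun v => by
    simp only [hD]
    linarith [Real.add_one_le_exp (2 * gW κ v)]
  have hI2 : Integrable (fun v => 2 * gW κ v) (stdGaussian V3) := hIg.const_mul 2
  have hI12 : Integrable (fun v => 1 + 2 * gW κ v) (stdGaussian V3) := (integrable_const 1).add hI2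
  have hID : Integrable D (stdGaussian V3) := hIe.sub hI12
  -- D > 0 at the point v* = (π/2, π/2, 0)
  set vstar : V3 := WithLp.toLp 2 ![Real.pi / 2, Real.pi / 2, 0] with hvstar
  have hgstar : gW κ vstar = κ := by
    simp [gW, hvstar, Real.sin_pi_div_two]
  have hDstar : 0 < D vstar := by
    simp only [hD, hgstar]
    have := Real.add_one_lt_exp (by positivity : 2 * κ ≠ 0)
    linarith
  have hDpos : 0 < ∫ v, D v ∂stdGaussian V3 := by
    rw [integral_pos_iff_support_of_nonneg hD0 hID]
    have hopen : IsOpen (Function.support D) := by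
      simp only [hD]
      exact isOpen_ne_fun (by fun_prop) continuous_const
    exact hopen.measure_pos _ ⟨vstar, hDstar.ne'⟩
  have hmean : ∫ v, gW κ v ∂stdGaussian V3 = 0 :=
    integral_stdGaussian_eq_zero_of_odd (ℝ ∙ bV 0)ᗮ.reflection (gW_reflect0 κ)
  have hsplit : ∫ v, Real.exp (2 * gW κ v) ∂stdGaussian V3 =
      (∫ v, D v ∂stdGaussian V3) + ∫ v, (1 + 2 * gW κ v) ∂stdGaussian V3 := by
    rw [← integral_add hID hI12]
    refine integral_congr_ae (Eventually.of_forall fun v => ?_)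
    simp only [hD]
    ring
  have h12 : ∫ v, (1 + 2 * gW κ v) ∂stdGaussian V3 = 1 := by
    rw [integral_add (integrable_const (1 : ℝ)) hI2, integral_const_mul, hmean, integral_const,
      smul_eq_mul, mul_one, probReal_univ]
    ring
  rw [hsplit, h12]
  linarith

/-! ## § 6 The per-volume slack is load-bearing: the per-particle variant is false (n = 1) -/

/-- `CellForecastPressureDecay` with the PER-VOLUME slack `e^{δ L³}` replaced by the per-particle
slack `e^{δ n}` (everything else verbatim). -/
def CellForecastPressureDecayPerParticle : Prop :=
  ∃ σ₀ : ℝ, 0 < σ₀ ∧ ∀ σ : ℝ, 0 < σ → σ < σ₀ → ∃ κ : ℝ, 0 < κ ∧ ∀ g : Literature.MathematicalPhysics.KineticTheory.V3 → ℝ, Continuous g → (∀ v, |g v| ≤ κ) → (∀ (c₀ c₂ : ℝ) (b : Literature.MathematicalPhysics.KineticTheory.V3), ∫ v, g v * (c₀ + inner ℝ b v + c₂ * ‖v‖ ^ 2) ∂(ProbabilityTheory.stdGaussian Literature.MathematicalPhysics.KineticTheory.V3) = 0) → ∀ δ : ℝ, 0 < δ → ∃ T : ℝ, 0 < T ∧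 ∃ R₀ : ℝ, 0 < R₀ ∧ ∀ R : ℝ, R₀ ≤ R → ∃ L₀ : ℝ, 0 < L₀ ∧ ∀ L : ℝ, L₀ ≤ L → ∀ n : ℕ, (n : ℝ) ≤ 2 * L ^ 3 → ∀ (Ψ : (k : ℕ) → Literature.Analysis.FluidPDE.HardSphereFlow (Literature.Analysis.FluidPDE.Euclidean.geometry (Fin 3)) σ k) (c : ℝ), |c| ≤ 1 → ∫⁻ z, ENNReal.ofReal (Real.exp (2 * c * ∑ i : Fin n, T⁻¹ * ∫ t in (0 : ℝ)..T, g (Literature.Analysis.FluidPDE.localClusterState Ψ R t z i).2)) ∂(Literature.Analysis.FluidPDE.particleLaw (Ψ n) (Literature.Analysis.FluidPDE.canonicalDensity (Literature.Analysis.FluidPDE.Euclidean.geometry (Fin 3)) σ n (fun p => Set.indicator {x : Literature.MathematicalPhysics.KineticTheory.V3 | ∀ k, x k ∈ Set.Icc (0 : ℝ) L} (fun _ => (1 : ℝ)) p.1 * Literature.Analysis.FluidPDE.globalMaxwellian p.2))) ≤ ENNReal.ofReal (Real.exp (δ * n))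

/-- **The per-volume slack is load-bearing**: with `e^{δ n}` in place of `e^{δ L³}` the statement
is false. Witness: `g = κ sin v₀ sin v₁` (admissible), `n = 1` (a lone particle flies freely, so
its window average is `g(v)` for every horizon `T`), `c = 1`, `δ = ½ log ∫ e^{2g} dγ > 0`:
the left side is `∫ e^{2g} dγ > e^{δ}`. -/
theorem cellForecastPressureDecay_false_perParticle : ¬ CellForecastPressureDecayPerParticle := by
  rintro ⟨σ₀, hσ₀, h⟩
  set σ : ℝ := σ₀ / 2 with hσdef
  have hσpos : 0 < σ := by positivity
  obtain ⟨κ, hκ, h⟩ := h σ hσpos (by linarith)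
  set J : ℝ := ∫ v, Real.exp (2 * gW κ v) ∂stdGaussian V3 with hJ
  have hJ1 : 1 < J := one_lt_integral_exp_gW hκ.ne'
  have hδ : 0 < Real.log J / 2 := by positivity [Real.log_pos hJ1]
  obtain ⟨T, hT, R₀, hR₀, h⟩ := h (gW κ) (continuous_gW κ) (abs_gW_le hκ.le) (gW_orthogonal κ)
    (Real.log J / 2) hδ
  obtain ⟨L₀, hL₀, h⟩ := h R₀ le_rfl
  set L : ℝ := max L₀ 1 with hLdef
  have hL1 : 1 ≤ L := le_max_right _ _
  set Ψ : (k : ℕ) → HardSphereFlow (Euclidean.geometry (Fin 3)) σ k :=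
    fun k => (HardSphereFlow.nonempty_holds hσpos k).some with hΨ
  have hL3 : (1 : ℝ) ≤ L ^ 3 := one_le_pow₀ hL1
  have key := h L (le_max_left _ _) 1 (by norm_num; linarith) Ψ 1 (by simp)
  simp_rw [windowAverage_one Ψ R₀ hT.ne' (gW κ) 1] at key
  have hFc : Continuous fun v : V3 => Real.exp (2 * 1 * gW κ v) :=
    (continuous_const.mul (continuous_gW κ)).rexp
  rw [← cellRef_eq, lintegral_cellLaw_one σ (by linarith) (Ψ 1) (F := fun v => Real.exp (2 * 1 * gW κ v))
      hFc.measurable (fun v => (Real.exp_pos _).le) ?_] at key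
  · rw [← integral_stdGaussian_eq_integral_mul_globalMaxwellian,
      ENNReal.ofReal_le_ofReal_iff (by positivity)] at key
    simp only [mul_one, Nat.cast_one] at key
    -- key : J ≤ exp (log J / 2)
    have hJpos : 0 < J := by linarith
    have hs : Real.exp (Real.log J / 2) = Real.sqrt J := by
      rw [Real.exp_half, Real.exp_log hJpos]
    have hs1 : 1 < Real.sqrt J := by
      rw [Real.lt_sqrt zero_le_one]
      simpa using hJ1
    have hss : Real.sqrt J * Real.sqrt J = J := Real.mul_self_sqrt hJpos.le
    rw [hs] at key
    nlinarith
  · -- integrability of M · e^{2g}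
    refine integrable_globalMaxwellian.mul_bdd (c := Real.exp (2 * κ)) hFc.aestronglyMeasurable
      (Eventually.of_forall fun v => ?_)
    rw [Real.norm_eq_abs, abs_of_pos (Real.exp_pos _)]
    refine Real.exp_le_exp.2 (?_ : 2 * 1 * gW κ v ≤ 2 * κ)
    have := abs_gW_le hκ.le v
    rw [abs_le] at this
    linarith [this.2]

/-! ## § 7 Near-miss (paper argument; the only `sorry` of this file — see the module docstring) -/

/-- `CellForecastPressureDecay` with the amplitude clause dropped: ALL bounded continuous
orthogonal `g` (the `κ` is replaced by an arbitrary bound `K` chosen with `g`). -/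
def CellForecastPressureDecayAllAmplitudes : Prop :=
  ∃ σ₀ : ℝ, 0 < σ₀ ∧ ∀ σ : ℝ, 0 < σ → σ < σ₀ → ∀ g : Literature.MathematicalPhysics.KineticTheory.V3 → ℝ, Continuous g → (∃ K : ℝ, ∀ v, |g v| ≤ K) → (∀ (c₀ c₂ : ℝ) (b : Literature.MathematicalPhysics.KineticTheory.V3), ∫ v, g v * (c₀ + inner ℝ b v + c₂ * ‖v‖ ^ 2) ∂(ProbabilityTheory.stdGaussian Literature.MathematicalPhysics.KineticTheory.V3) = 0) → ∀ δ : ℝ, 0 < δ → ∃ T : ℝ, 0 < T ∧ ∃ R₀ : ℝ, 0 < R₀ ∧ ∀ R : ℝ, R₀ ≤ R → ∃ L₀ : ℝ, 0 < L₀ ∧ ∀ L : ℝ, L₀ ≤ L → ∀ n : ℕ, (n : ℝ) ≤ 2 * L ^ 3 → ∀ (Ψ : (k : ℕ) → Literature.Analysis.FluidPDE.HardSphereFlow (Literature.Analysis.FluidPDE.Euclidean.geometry (Fin 3)) σ k) (c : ℝ), |c| ≤ 1 → ∫⁻ z, ENNReal.ofReal (Real.exp (2 * c * ∑ i : Fin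 n, T⁻¹ * ∫ t in (0 : ℝ)..T, g (Literature.Analysis.FluidPDE.localClusterState Ψ R t z i).2)) ∂(Literature.Analysis.FluidPDE.particleLaw (Ψ n) (Literature.Analysis.FluidPDE.canonicalDensity (Literature.Analysis.FluidPDE.Euclidean.geometry (Fin 3)) σ n (fun p => Set.indicator {x : Literature.MathematicalPhysics.KineticTheory.V3 | ∀ k, x k ∈ Set.Icc (0 : ℝ) L} (fun _ => (1 : ℝ)) p.1 * Literature.Analysis.FluidPDE.globalMaxwellian p.2))) ≤ ENNReal.ofReal (Real.exp (δ * L ^ 3))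

/-- Sanity: the all-amplitudes variant implies the crux (take `κ := 1`, `K := κ`). -/
theorem cellForecastPressureDecay_of_allAmplitudes (h : CellForecastPressureDecayAllAmplitudes) :
    Summit.AtomisticToContinuum.HydrodynamicLimit.Theses.AntiMazurCoboundaries.CellForecastPressureDecay := by
  obtain ⟨σ₀, hσ₀, h⟩ := h
  refine ⟨σ₀, hσ₀, fun σ hσ hσ' => ⟨1, one_pos, fun g hg hgb horth => h σ hσ hσ' g hg ⟨1, hgb⟩ horth⟩⟩

/-- NEAR-MISS (paper proof only; NOT expected to be formalisable with the present tree): the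
amplitude clause is load-bearing. Paper witness: `g = K·g₁` with `g₁` admissible and
`G(θ') := E_{N(0,θ')} g₁` having `G''(1) ≠ 0` (e.g. a radial bump re-orthogonalised to `1, |v|²`),
`K` large, `c = 1`, `R ≥ L√3` (cluster = whole cell), temperature tilt `θ' = 1 + s` of the cell law:
Donsker–Varadhan gives `L⁻³ log ∫⁻ e^{2∑A_i} dP ≥ ρ [2K·(time-avg of E g₁) − (3/2)(s − log(1+s))]`,
and for bulk particles (distance `≫ T·speed` from the cell boundary) energy conservation of the
isolated cluster keeps the one-body law Maxwellian(θ') on `[0,T]`, so the gain is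
`2K G(1+s) = K G''(1) s² + o(s²)`, beating the cost `(3/4)s² + o(s²)` once `K G''(1) > 3/4`.
Lean obstruction: needs (1) finite speed of influence for the expanding cluster (the forecast does
NOT preserve `P_{n,L}`), (2) equivalence of ensembles on the energy shell; neither is in the tree. -/
theorem cellForecastPressureDecay_false_allAmplitudes : ¬ CellForecastPressureDecayAllAmplitudes := by
  sorry

/-! ## § 8 The innermost tilt cap `|c| ≤ 1` is load-bearing (`c` is quantified after `L`) -/

/-- `CellForecastPressureDecay` with the tilt cap `|c| ≤ 1` DROPPED (all real `c`; everything else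
verbatim). Since `c` is the innermost quantifier (after `L`), this is uniformity in the tilt. -/
def CellForecastPressureDecayAllTilts : Prop :=
  ∃ σ₀ : ℝ, 0 < σ₀ ∧ ∀ σ : ℝ, 0 < σ → σ < σ₀ → ∃ κ : ℝ, 0 < κ ∧ ∀ g : Literature.MathematicalPhysics.KineticTheory.V3 → ℝ, Continuous g → (∀ v, |g v| ≤ κ) → (∀ (c₀ c₂ : ℝ) (b : Literature.MathematicalPhysics.KineticTheory.V3), ∫ v, g v * (c₀ + inner ℝ b v + c₂ * ‖v‖ ^ 2) ∂(ProbabilityTheory.stdGaussian Literature.MathematicalPhysics.KineticTheory.V3) = 0) → ∀ δ : ℝ, 0 < δ → ∃ T : ℝ, 0 < T ∧ ∃ R₀ : ℝ, 0 < R₀ ∧ ∀ R : ℝ, R₀ ≤ R → ∃ L₀ : ℝ, 0 < L₀ ∧ ∀ L : ℝ, L₀ ≤ L → ∀ n : ℕ, (n : ℝ) ≤ 2 * L ^ 3 → ∀ (Ψ : (k : ℕ) → Literature.Analysis.FluidPDE.HardSphereFlow (Literature.Analysis.FluidPDE.Euclidean.geometry (Fin 3)) σ k) (c : ℝ), ∫⁻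 z, ENNReal.ofReal (Real.exp (2 * c * ∑ i : Fin n, T⁻¹ * ∫ t in (0 : ℝ)..T, g (Literature.Analysis.FluidPDE.localClusterState Ψ R t z i).2)) ∂(Literature.Analysis.FluidPDE.particleLaw (Ψ n) (Literature.Analysis.FluidPDE.canonicalDensity (Literature.Analysis.FluidPDE.Euclidean.geometry (Fin 3)) σ n (fun p => Set.indicator {x : Literature.MathematicalPhysics.KineticTheory.V3 | ∀ k, x k ∈ Set.Icc (0 : ℝ) L} (fun _ => (1 : ℝ)) p.1 * Literature.Analysis.FluidPDE.globalMaxwellian p.2))) ≤ ENNReal.ofReal (Real.exp (δ * L ^ 3))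

/-- Sanity: the all-tilts variant is the crux with one hypothesis fewer (so it implies the crux). -/
theorem cellForecastPressureDecay_of_allTilts (h : CellForecastPressureDecayAllTilts) :
    Summit.AtomisticToContinuum.HydrodynamicLimit.Theses.AntiMazurCoboundaries.CellForecastPressureDecay := by
  obtain ⟨σ₀, hσ₀, h⟩ := h
  refine ⟨σ₀, hσ₀, fun σ hσ hσ' => ?_⟩
  obtain ⟨κ, hκ, h⟩ := h σ hσ hσ'
  refine ⟨κ, hκ, fun g hg hgb horth δ hδ => ?_⟩
  obtain ⟨T, hT, R₀, hR₀, h⟩ := h g hg hgb horth δ hδ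
  refine ⟨T, hT, R₀, hR₀, fun R hR => ?_⟩
  obtain ⟨L₀, hL₀, h⟩ := h R hR
  exact ⟨L₀, hL₀, fun L hL n hn Ψ c _ => h L hL n hn Ψ c⟩

/-- **The tilt cap is load-bearing**: with `∀ c : ℝ` in place of `∀ |c| ≤ 1` the statement is false.
Witness: `n = 1` (a lone particle flies freely, the functional is `∫ e^{2cg} dγ` at every horizon),
`g = κ sin v₀ sin v₁`, and — `c` being chosen AFTER `L` — the tilt `c = (L³ + 1 − log γ{g > κ/2})/κ`:
Chebyshev gives `∫ e^{2cg} dγ ≥ e^{cκ} γ{g > κ/2} > e^{L³}`. So any proof uses `|c| ≤ 1`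
quantitatively (equivalently: the amplitude that matters is `|c|κ`). -/
theorem cellForecastPressureDecay_false_allTilts : ¬ CellForecastPressureDecayAllTilts := by
  rintro ⟨σ₀, hσ₀, h⟩
  set σ : ℝ := σ₀ / 2 with hσdef
  have hσpos : 0 < σ := by positivity
  obtain ⟨κ, hκ, h⟩ := h σ hσpos (by linarith)
  obtain ⟨T, hT, R₀, hR₀, h⟩ :=
    h (gW κ) (continuous_gW κ) (abs_gW_le hκ.le) (gW_orthogonal κ) 1 one_pos
  obtain ⟨L₀, hL₀, h⟩ := h R₀ le_rfl
  set L : ℝ := max L₀ 1 with hLdef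
  have hL1 : 1 ≤ L := le_max_right _ _
  set Ψ : (k : ℕ) → HardSphereFlow (Euclidean.geometry (Fin 3)) σ k :=
    fun k => (HardSphereFlow.nonempty_holds hσpos k).some with hΨ
  -- the set where `g > κ/2` has positive Gaussian measure
  haveI := isOpenPosMeasure_stdGaussian (E := V3)
  set S : Set V3 := {v | κ / 2 < gW κ v} with hSdef
  have hSo : IsOpen S := isOpen_lt continuous_const (continuous_gW κ)
  set vstar : V3 := WithLp.toLp 2 ![Real.pi / 2, Real.pi / 2, 0] with hvstar
  have hgstar : gW κ vstar = κ := by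
    simp [gW, hvstar, Real.sin_pi_div_two]
  have hSne : S.Nonempty := ⟨vstar, by simp only [hSdef, mem_setOf_eq, hgstar]; linarith⟩
  set p : ℝ := (stdGaussian V3).real S with hpdef
  have hp : 0 < p := by
    rw [hpdef, Measure.real, ENNReal.toReal_pos_iff]
    exact ⟨hSo.measure_pos _ hSne, measure_lt_top _ _⟩
  have hlogp : Real.log p ≤ 0 := Real.log_nonpos hp.le (by
    rw [hpdef]; exact measureReal_le_one)  -- probability measure
  -- the tilt, chosen after `L`
  set c : ℝ := (L ^ 3 + 1 - Real.log p) / κ with hcdef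
  have hL3 : (1 : ℝ) ≤ L ^ 3 := one_le_pow₀ hL1
  have hc0 : 0 ≤ c := by
    rw [hcdef]
    exact div_nonneg (by linarith) hκ.le
  have hcκ : c * κ = L ^ 3 + 1 - Real.log p := by
    rw [hcdef, div_mul_cancel₀ _ hκ.ne']
  have key := h L (le_max_left _ _) 1 (by norm_num; linarith) Ψ c
  simp_rw [windowAverage_one Ψ R₀ hT.ne' (gW κ) c] at key
  have hFc : Continuous fun v : V3 => Real.exp (2 * c * gW κ v) :=
    (continuous_const.mul (continuous_gW κ)).rexp
  have hbound : ∀ v, Real.exp (2 * c * gW κ v) ≤ Real.exp (2 * c * κ) := by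
    intro v
    refine Real.exp_le_exp.2 ?_
    have := abs_gW_le hκ.le v
    rw [abs_le] at this
    nlinarith [this.2]
  rw [← cellRef_eq, lintegral_cellLaw_one σ (by linarith) (Ψ 1)
      (F := fun v => Real.exp (2 * c * gW κ v)) hFc.measurable (fun v => (Real.exp_pos _).le) ?_] at key
  · rw [← integral_stdGaussian_eq_integral_mul_globalMaxwellian,
      ENNReal.ofReal_le_ofReal_iff (by positivity)] at key
    simp only [one_mul] at key
    -- key : ∫ exp (2c g) dγ ≤ exp (L ^ 3)
    have hInt : Integrable (fun v => Real.exp (2 * c * gW κ v)) (stdGaussian V3) :=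
      (integrable_const (Real.exp (2 * c * κ))).mono' hFc.aestronglyMeasurable
        (Eventually.of_forall fun v => by
          rw [Real.norm_eq_abs, abs_of_pos (Real.exp_pos _)]; exact hbound v)
    have hcheb := mul_meas_ge_le_integral_of_nonneg
      (Eventually.of_forall fun v => (Real.exp_pos (2 * c * gW κ v)).le) hInt (Real.exp (c * κ))
    have hsub : S ⊆ {v | Real.exp (c * κ) ≤ Real.exp (2 * c * gW κ v)} := by
      intro v hv
      simp only [hSdef, mem_setOf_eq] at hv ⊢
      refine Real.exp_le_exp.2 ?_
      nlinarith
    have hmono : p ≤ (stdGaussian V3).real {v | Real.exp (c * κ) ≤ Real.exp (2 * c * gW κ v)} :=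
      measureReal_mono hsub
    have hlow : Real.exp (c * κ) * p ≤ Real.exp (L ^ 3) :=
      le_trans (le_trans (mul_le_mul_of_nonneg_left hmono (Real.exp_pos _).le) hcheb) key
    -- but exp(cκ) p = exp(L³ + 1 - log p) p = exp(L³+1) > exp(L³)
    have hexp : Real.exp (c * κ) * p = Real.exp (L ^ 3 + 1) := by
      rw [hcκ, sub_eq_add_neg, Real.exp_add, Real.exp_neg, Real.exp_log hp]
      field_simp
    rw [hexp] at hlow
    have := Real.exp_lt_exp.2 (by linarith : L ^ 3 < L ^ 3 + 1)
    linarith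
  · -- integrability of M · e^{2cg}
    refine integrable_globalMaxwellian.mul_bdd (c := Real.exp (2 * c * κ)) hFc.aestronglyMeasurable
      (Eventually.of_forall fun v => ?_)
    rw [Real.norm_eq_abs, abs_of_pos (Real.exp_pos _)]
    exact hbound v


/-! ## § 9 The fixed-range floor: isolated particles never thermalise (`R₀` must depend on `δ`) -/

section FixedRange

/-- The CORE of the lattice cell `q ∈ (Fin 3 → Fin m)` of side `ℓ` with margin `R`: the open box
`Π_k (q_k ℓ, q_k ℓ + (ℓ - R))`. Points in cores of distinct cells are `> R` apart. -/
def cellCore (ℓ R : ℝ) {m : ℕ} (q : Fin 3 → Fin m) : Set V3 :=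
  {x : V3 | ∀ k, ((q k : ℕ) : ℝ) * ℓ < x k ∧ x k < ((q k : ℕ) : ℝ) * ℓ + (ℓ - R)}

theorem cellCore_eq_preimage (ℓ R : ℝ) {m : ℕ} (q : Fin 3 → Fin m) :
    cellCore ℓ R q = (WithLp.ofLp : V3 → (Fin 3 → ℝ)) ⁻¹'
      Set.univ.pi (fun k => Set.Ioo (((q k : ℕ) : ℝ) * ℓ) (((q k : ℕ) : ℝ) * ℓ + (ℓ - R))) := by
  ext x
  simp [cellCore]

theorem measurableSet_cellCore (ℓ R : ℝ) {m : ℕ} (q : Fin 3 → Fin m) : MeasurableSet (cellCore ℓ R q) := by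
  rw [cellCore_eq_preimage]
  exact (MeasurableSet.univ_pi fun _ => measurableSet_Ioo).preimage
    (PiLp.volume_preserving_ofLp (Fin 3)).measurable

/-- The volume of a cell core is `(ℓ - R)³` (for `R ≤ ℓ`). -/
theorem volume_cellCore {ℓ R : ℝ} (hRℓ : R ≤ ℓ) {m : ℕ} (q : Fin 3 → Fin m) :
    volume (cellCore ℓ R q) = ENNReal.ofReal ((ℓ - R) ^ 3) := by
  rw [cellCore_eq_preimage, (PiLp.volume_preserving_ofLp (Fin 3)).measure_preimage
      (MeasurableSet.univ_pi fun _ => measurableSet_Ioo).nullMeasurableSet, Real.volume_pi_Ioo]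
  simp only [add_sub_cancel_left, Finset.prod_const, Finset.card_univ, Fintype.card_fin]
  rw [ENNReal.ofReal_pow (by linarith)]

/-- Points in the cores of two distinct cells are more than `R` apart (in some coordinate, hence in
norm). -/
theorem lt_norm_sub_of_mem_cellCore {ℓ R : ℝ} (hℓ : 0 ≤ ℓ) {m : ℕ} {q q' : Fin 3 → Fin m} (hqq' : q ≠ q')
    {x y : V3} (hx : x ∈ cellCore ℓ R q) (hy : y ∈ cellCore ℓ R q') : R < ‖x - y‖ := by
  obtain ⟨k, hk⟩ := Function.ne_iff.1 hqq'
  have h1 := hx k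
  have h2 := hy k
  refine lt_of_lt_of_le ?_ (abs_apply_sub_apply_le x y k)
  have hk' : (q k : ℕ) ≠ (q' k : ℕ) := fun h => hk (Fin.ext h)
  rcases lt_or_gt_of_ne hk' with h | h
  · have h3 : ((q k : ℕ) : ℝ) + 1 ≤ ((q' k : ℕ) : ℝ) := by exact_mod_cast h
    have h4 : ((q k : ℕ) : ℝ) * ℓ + ℓ ≤ ((q' k : ℕ) : ℝ) * ℓ := by nlinarith
    refine lt_abs.2 (Or.inr ?_)
    linarith [h1.2, h2.1]
  · have h3 : ((q' k : ℕ) : ℝ) + 1 ≤ ((q k : ℕ) : ℝ) := by exact_mod_cast h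
    have h4 : ((q' k : ℕ) : ℝ) * ℓ + ℓ ≤ ((q k : ℕ) : ℝ) * ℓ := by nlinarith
    refine lt_abs.2 (Or.inl ?_)
    linarith [h1.1, h2.2]

/-- A cell core lies inside the cube `[0, m ℓ]³`. -/
theorem cellCore_subset_cellCube {ℓ R : ℝ} (hℓ : 0 ≤ ℓ) (hR : 0 ≤ R) {m : ℕ} (q : Fin 3 → Fin m) :
    cellCore ℓ R q ⊆ cellCube ((m : ℝ) * ℓ) := by
  intro x hx k
  have h := hx k
  have hq0 : (0 : ℝ) ≤ ((q k : ℕ) : ℝ) := Nat.cast_nonneg _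
  have hq1 : ((q k : ℕ) : ℝ) + 1 ≤ (m : ℝ) := by exact_mod_cast (q k).isLt
  have hq2 : ((q k : ℕ) : ℝ) * ℓ + ℓ ≤ (m : ℝ) * ℓ := by nlinarith
  have hq3 : (0 : ℝ) ≤ ((q k : ℕ) : ℝ) * ℓ := mul_nonneg hq0 hℓ
  constructor
  · linarith [h.1]
  · linarith [h.2]

variable {n m : ℕ}

/-- On the isolated-particles event of an injective cell assignment `φ` (particle `i` in the core of
cell `φ i`), every range-`R` cluster is a singleton. -/
theorem card_rangeCluster_le_one_of_mem_cellCore {ℓ R : ℝ} (hℓ : 0 ≤ ℓ) (φ : Fin n ↪ (Fin 3 → Fin m))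
    {z : Config n (Fin 3) V3} (hz : ∀ i, (z i).1 ∈ cellCore ℓ R (φ i)) (i : Fin n) :
    (rangeCluster (Euclidean.geometry (Fin 3)) R z i).card ≤ 1 := by
  have key : ∀ j ∈ rangeCluster (Euclidean.geometry (Fin 3)) R z i, j = i := by
    intro j hj
    rcases mem_rangeCluster.1 hj with h | h
    · exact h
    · by_contra hji
      have hne : φ i ≠ φ j := fun h' => hji (φ.injective h').symm
      have := lt_norm_sub_of_mem_cellCore hℓ hne (hz i) (hz j)
      rw [Euclidean.geometry_sepVec] at h
      linarith
  exact Finset.card_le_one.2 fun a ha b hb => by rw [key a ha, key b hb]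

/-- The isolated-particles event lies in the hard-sphere domain as soon as `σ ≤ R`. -/
theorem mem_hardSphereDomain_of_mem_cellCore {ℓ R σ : ℝ} (hℓ : 0 ≤ ℓ) (hσR : σ ≤ R)
    (φ : Fin n ↪ (Fin 3 → Fin m)) {z : Config n (Fin 3) V3} (hz : ∀ i, (z i).1 ∈ cellCore ℓ R (φ i)) :
    z ∈ hardSphereDomain (Euclidean.geometry (Fin 3)) n σ := by
  rw [mem_hardSphereDomain]
  intro i j hij
  rw [Euclidean.geometry_sepVec]
  have hne : φ i ≠ φ j := fun h' => hij (φ.injective h')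
  exact hσR.trans (lt_norm_sub_of_mem_cellCore hℓ hne (hz i) (hz j)).le

/-- Distinct injective assignments give disjoint isolated-particles events (for `R ≥ 0`). -/
theorem eq_of_mem_cellCore_of_mem_cellCore {ℓ R : ℝ} (hℓ : 0 ≤ ℓ) (hR : 0 ≤ R) {φ ψ : Fin n ↪ (Fin 3 → Fin m)}
    {z : Config n (Fin 3) V3} (hφ : ∀ i, (z i).1 ∈ cellCore ℓ R (φ i)) (hψ : ∀ i, (z i).1 ∈ cellCore ℓ R (ψ i)) :
    φ = ψ := by
  ext i : 1
  by_contra hne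
  have := lt_norm_sub_of_mem_cellCore hℓ hne (hφ i) (hψ i)
  rw [sub_self, norm_zero] at this
  linarith

/-- The isolated-particles event is measurable. -/
theorem measurableSet_isoEvent (ℓ R : ℝ) (φ : Fin n ↪ (Fin 3 → Fin m)) :
    MeasurableSet {z : Config n (Fin 3) V3 | ∀ i, (z i).1 ∈ cellCore ℓ R (φ i)} := by
  have : {z : Config n (Fin 3) V3 | ∀ i, (z i).1 ∈ cellCore ℓ R (φ i)} =
      ⋂ i, (fun z : Config n (Fin 3) V3 => (z i).1) ⁻¹' cellCore ℓ R (φ i) := by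
    ext z; simp
  rw [this]
  exact MeasurableSet.iInter fun i => (measurableSet_cellCore ℓ R (φ i)).preimage (measurable_pi_apply i).fst

/-- The one-particle factor of the isolated-particles integrand. -/
def isoFactor (ℓ R : ℝ) (q : Fin 3 → Fin m) (g : V3 → ℝ) (p : V3 × V3) : ℝ :=
  (cellCore ℓ R q).indicator (fun _ => (1 : ℝ)) p.1 * (globalMaxwellian p.2 * Real.exp (2 * g p.2))

theorem isoFactor_nonneg (ℓ R : ℝ) (q : Fin 3 → Fin m) (g : V3 → ℝ) (p : V3 × V3) :
    0 ≤ isoFactor ℓ R q g p :=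
  mul_nonneg (Set.indicator_nonneg (fun _ _ => zero_le_one) _)
    (mul_nonneg (globalMaxwellian_pos p.2).le (Real.exp_pos _).le)

theorem integrable_maxwellian_mul_exp {g : V3 → ℝ} (hg : Continuous g) {κ : ℝ} (hgb : ∀ v, |g v| ≤ κ) :
    Integrable fun v : V3 => globalMaxwellian v * Real.exp (2 * g v) := by
  refine integrable_globalMaxwellian.mul_bdd (c := Real.exp (2 * κ))
    (continuous_const.mul hg).rexp.aestronglyMeasurable (Eventually.of_forall fun v => ?_)
  rw [Real.norm_eq_abs, abs_of_pos (Real.exp_pos _)]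
  refine Real.exp_le_exp.2 ?_
  have := hgb v
  rw [abs_le] at this
  linarith [this.2]

theorem integrable_isoFactor (ℓ R : ℝ) (q : Fin 3 → Fin m) {g : V3 → ℝ} (hg : Continuous g) {κ : ℝ}
    (hgb : ∀ v, |g v| ≤ κ) : Integrable (isoFactor ℓ R q g) := by
  have h1 : Integrable (fun x : V3 => (cellCore ℓ R q).indicator (fun _ => (1 : ℝ)) x) := by
    rw [integrable_indicator_iff (measurableSet_cellCore ℓ R q)]
    refine integrableOn_const ?_
    rw [cellCore_eq_preimage, (PiLp.volume_preserving_ofLp (Fin 3)).measure_preimage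
      (MeasurableSet.univ_pi fun _ => measurableSet_Ioo).nullMeasurableSet, Real.volume_pi_Ioo]
    exact (ENNReal.prod_lt_top fun _ _ => ENNReal.ofReal_lt_top).ne
  have h := h1.mul_prod (integrable_maxwellian_mul_exp hg hgb)
  rw [← Measure.volume_eq_prod] at h
  exact h

/-- `∫ isoFactor = (ℓ - R)³ · ∫ M e^{2g}`. -/
theorem integral_isoFactor {ℓ R : ℝ} (hRℓ : R ≤ ℓ) (q : Fin 3 → Fin m) (g : V3 → ℝ) :
    ∫ p, isoFactor ℓ R q g p = (ℓ - R) ^ 3 * ∫ v, globalMaxwellian v * Real.exp (2 * g v) := by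
  unfold isoFactor
  rw [Measure.volume_eq_prod, integral_prod_mul (μ := volume) (ν := volume)
      (fun x : V3 => (cellCore ℓ R q).indicator (fun _ => (1 : ℝ)) x)
      (fun v : V3 => globalMaxwellian v * Real.exp (2 * g v)),
    integral_indicator_const _ (measurableSet_cellCore ℓ R q), smul_eq_mul, mul_one, Measure.real,
    volume_cellCore hRℓ, ENNReal.toReal_ofReal (pow_nonneg (by linarith) 3)]

/-- `Z ≤ (L³)ⁿ`: the cell partition function is at most the free one. -/
theorem canonicalPartition_cell_le (σ : ℝ) {L : ℝ} (hL : 0 ≤ L) (n : ℕ) :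
    canonicalPartition (Euclidean.geometry (Fin 3)) σ n (cellRef L) ≤ (L ^ 3) ^ n := by
  rw [canonicalPartition]
  have hint : Integrable ((hardSphereDomain (Euclidean.geometry (Fin 3)) n σ).indicator
      (tensorPow n (cellRef L))) :=
    (integrable_tensorPow n (integrable_cellRef L)).indicator
      (measurableSet_hardSphereDomain _ Euclidean.measurable_geometry_sepVec n σ)
  calc ∫ z, (hardSphereDomain (Euclidean.geometry (Fin 3)) n σ).indicator (tensorPow n (cellRef L)) z
      ≤ ∫ z, tensorPow n (cellRef L) z :=
        integral_mono hint (integrable_tensorPow n (integrable_cellRef L))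
          (Set.indicator_le_self' fun z _ => tensorPow_nonneg (cellRef_nonneg L) n z)
    _ = (∫ p, cellRef L p) ^ n := by
        simp only [tensorPow]
        rw [integral_fintype_prod_volume_eq_pow, Fintype.card_fin]
    _ = (L ^ 3) ^ n := by rw [integral_cellRef hL]

/-- **The isolated-particles lower bound, one assignment.** Under the cell law `P_{n,L}`, `L = mℓ`,
`σ ≤ R ≤ ℓ`, the contribution of the event "particle `i` in the core of cell `φ i`" to
`∫⁻ e^{2 ∑ g(v_i)} dP` is exactly `Z⁻¹ ((ℓ-R)³ ∫ M e^{2g})ⁿ`. -/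
theorem lintegral_isoEvent {σ ℓ R L : ℝ} (hℓ : 0 ≤ ℓ) (hR : 0 ≤ R) (hσR : σ ≤ R) (hRℓ : R ≤ ℓ)
    (hL : L = (m : ℝ) * ℓ)
    (Φ : HardSphereFlow (Euclidean.geometry (Fin 3)) σ n) {g : V3 → ℝ} (hg : Continuous g) {κ : ℝ}
    (hgb : ∀ v, |g v| ≤ κ) (φ : Fin n ↪ (Fin 3 → Fin m)) :
    ∫⁻ z, {z : Config n (Fin 3) V3 | ∀ i, (z i).1 ∈ cellCore ℓ R (φ i)}.indicator
        (fun z => ENNReal.ofReal (Real.exp (2 * ∑ i, g (z i).2))) z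
        ∂(particleLaw Φ (canonicalDensity (Euclidean.geometry (Fin 3)) σ n (cellRef L))) =
      ENNReal.ofReal ((canonicalPartition (Euclidean.geometry (Fin 3)) σ n (cellRef L))⁻¹ *
        ((ℓ - R) ^ 3 * ∫ v, globalMaxwellian v * Real.exp (2 * g v)) ^ n) := by
  have hLdef := hL
  set Z : ℝ := canonicalPartition (Euclidean.geometry (Fin 3)) σ n (cellRef L) with hZdef
  set D := hardSphereDomain (Euclidean.geometry (Fin 3)) n σ with hDdef
  set S : Set (Config n (Fin 3) V3) := {z | ∀ i, (z i).1 ∈ cellCore ℓ R (φ i)} with hSdef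
  have hSm : MeasurableSet S := measurableSet_isoEvent ℓ R φ
  have hZ0 : 0 ≤ Z := by
    rw [hZdef, canonicalPartition]
    exact integral_nonneg fun z => Set.indicator_nonneg (fun w _ => tensorPow_nonneg (cellRef_nonneg L) n w) z
  -- measurability of the density and of the integrand
  have hDm : MeasurableSet D := measurableSet_hardSphereDomain _ Euclidean.measurable_geometry_sepVec n σ
  have htp : Measurable (tensorPow n (cellRef L) : Config n (Fin 3) V3 → ℝ) :=
    Finset.measurable_prod _ fun i _ => (measurable_cellRef L).comp (measurable_pi_apply i)
  have hdens : Measurable fun z : Config n (Fin 3) V3 =>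
      ENNReal.ofReal (canonicalDensity (Euclidean.geometry (Fin 3)) σ n (cellRef L) z) :=
    ((htp.indicator hDm).const_mul _).ennreal_ofReal
  have hgsum : Continuous fun z : Config n (Fin 3) V3 => ∑ i, g (z i).2 :=
    continuous_finsetSum _ fun i _ => hg.comp ((continuous_apply i).snd)
  have hF₀ : Measurable fun z : Config n (Fin 3) V3 => ENNReal.ofReal (Real.exp (2 * ∑ i, g (z i).2)) :=
    (continuous_const.mul hgsum).rexp.measurable.ennreal_ofReal
  rw [particleLaw_eq, liouville_eq, lintegral_withDensity_eq_lintegral_mul _ hdens (hF₀.indicator hSm)]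
  -- the integrand vanishes off S ⊆ D
  have hSD : S ⊆ D := fun z hz => mem_hardSphereDomain_of_mem_cellCore hℓ hσR φ hz
  have hprod : ((fun z : Config n (Fin 3) V3 =>
      ENNReal.ofReal (canonicalDensity (Euclidean.geometry (Fin 3)) σ n (cellRef L) z)) *
        S.indicator fun z => ENNReal.ofReal (Real.exp (2 * ∑ i, g (z i).2))) =
      fun z => ENNReal.ofReal (Z⁻¹ * ∏ i, isoFactor ℓ R (φ i) g (z i)) := by
    funext z
    simp only [Pi.mul_apply]
    by_cases hz : z ∈ S
    · have hzD : z ∈ D := hSD hz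
      rw [indicator_of_mem hz, canonicalDensity, ← hZdef, ← hDdef, indicator_of_mem hzD,
        ← ENNReal.ofReal_mul (mul_nonneg (inv_nonneg.2 hZ0) (tensorPow_nonneg (cellRef_nonneg L) n z)),
        mul_assoc]
      congr 2
      rw [tensorPow, Finset.mul_sum, Real.exp_sum, ← Finset.prod_mul_distrib]
      refine Finset.prod_congr rfl fun i _ => ?_
      have hxi : (z i).1 ∈ cellCore ℓ R (φ i) := hz i
      have hxin : (z i).1 ∈ {x : V3 | ∀ k, x k ∈ Set.Icc (0 : ℝ) L} := by
        rw [hLdef]; exact cellCore_subset_cellCube hℓ hR (φ i) hxi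
      simp only [isoFactor, cellRef, indicator_of_mem hxin, indicator_of_mem hxi, one_mul]
    · rw [indicator_of_notMem hz, mul_zero]
      have : ∃ i, (z i).1 ∉ cellCore ℓ R (φ i) := by
        by_contra hall
        push Not at hall
        exact hz hall
      obtain ⟨i, hi⟩ := this
      rw [Finset.prod_eq_zero (Finset.mem_univ i) (by simp only [isoFactor, indicator_of_notMem hi, zero_mul]),
        mul_zero, ENNReal.ofReal_zero]
  have hsupp : Function.support (((fun z : Config n (Fin 3) V3 =>
      ENNReal.ofReal (canonicalDensity (Euclidean.geometry (Fin 3)) σ n (cellRef L) z)) *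
        S.indicator fun z => ENNReal.ofReal (Real.exp (2 * ∑ i, g (z i).2)))) ⊆ D := by
    intro z hz
    by_contra hzD
    have hzS : z ∉ S := fun h => hzD (hSD h)
    simp only [Function.mem_support, Pi.mul_apply, indicator_of_notMem hzS, mul_zero, ne_eq,
      not_true_eq_false] at hz
  rw [setLIntegral_eq_of_support_subset hsupp, hprod]
  -- now a product integral w.r.t. Lebesgue measure on the configuration space
  have hint : Integrable fun z : Config n (Fin 3) V3 => Z⁻¹ * ∏ i, isoFactor ℓ R (φ i) g (z i) := by
    have := Integrable.fintype_prod (ι := Fin n) (μ := fun _ => (volume : Measure (V3 × V3)))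
      (f := fun i => isoFactor ℓ R (φ i) g) fun i => integrable_isoFactor ℓ R (φ i) hg hgb
    rw [← volume_pi] at this
    exact this.const_mul _
  have hnn : 0 ≤ᵐ[volume] fun z : Config n (Fin 3) V3 => Z⁻¹ * ∏ i, isoFactor ℓ R (φ i) g (z i) :=
    Eventually.of_forall fun z => mul_nonneg (inv_nonneg.2 hZ0)
      (Finset.prod_nonneg fun i _ => isoFactor_nonneg ℓ R (φ i) g (z i))
  rw [← ofReal_integral_eq_lintegral_ofReal hint hnn, integral_const_mul]
  congr 2
  rw [integral_fintype_prod_volume_eq_prod (ι := Fin n) (fun i => isoFactor ℓ R (φ i) g)]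
  simp only [integral_isoFactor hRℓ, Finset.prod_const, Finset.card_univ, Fintype.card_fin]


/-- Measurability of the isolated-particles integrand `e^{2 ∑ g(v_i)}`. -/
theorem measurable_expSum {g : V3 → ℝ} (hg : Continuous g) :
    Measurable fun z : Config n (Fin 3) V3 => ENNReal.ofReal (Real.exp (2 * ∑ i, g (z i).2)) :=
  (continuous_const.mul (continuous_finsetSum _ fun i _ =>
    hg.comp ((continuous_apply i).snd))).rexp.measurable.ennreal_ofReal

/-- **Domination**: the sum over injective cell assignments of the isolated-particles integrands is
below the crux integrand at `c = 1` — on the event of `φ` every range-`R` cluster is a singleton, so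
every forecast is free flight and the window average of `g` is `g(v_i)` at every horizon `T`; the
events are pairwise disjoint; off their union the sum vanishes. -/
theorem sum_indicator_le_cruxIntegrand {σ ℓ R T : ℝ} (hℓ : 0 ≤ ℓ) (hR : 0 ≤ R) (hT : T ≠ 0)
    (Ψ : (k : ℕ) → HardSphereFlow (Euclidean.geometry (Fin 3)) σ k) (g : V3 → ℝ)
    (z : Config n (Fin 3) V3) :
    ∑ φ : Fin n ↪ (Fin 3 → Fin m), {z : Config n (Fin 3) V3 | ∀ i, (z i).1 ∈ cellCore ℓ R (φ i)}.indicator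
        (fun z => ENNReal.ofReal (Real.exp (2 * ∑ i, g (z i).2))) z ≤
      ENNReal.ofReal (Real.exp (2 * 1 * ∑ i : Fin n, T⁻¹ * ∫ t in (0 : ℝ)..T,
        g (localClusterState Ψ R t z i).2)) := by
  by_cases h : ∃ φ : Fin n ↪ (Fin 3 → Fin m), ∀ i, (z i).1 ∈ cellCore ℓ R (φ i)
  · obtain ⟨φ, hφ⟩ := h
    rw [Finset.sum_eq_single_of_mem φ (Finset.mem_univ _) (fun ψ _ hne => ?_)]
    · rw [indicator_of_mem (show z ∈ {z : Config n (Fin 3) V3 | ∀ i, (z i).1 ∈ cellCore ℓ R (φ i)} from hφ)]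
      have hcard : ∀ i, (rangeCluster (Euclidean.geometry (Fin 3)) R z i).card ≤ 1 :=
        card_rangeCluster_le_one_of_mem_cellCore hℓ φ hφ
      simp only [vel_localClusterState_of_card_le_one Ψ (hcard _), intervalIntegral.integral_const,
        sub_zero, smul_eq_mul, inv_mul_cancel_left₀ hT, mul_one, le_refl]
    · exact indicator_of_notMem (fun hψ : ∀ i, (z i).1 ∈ cellCore ℓ R (ψ i) =>
        hne (eq_of_mem_cellCore_of_mem_cellCore hℓ hR hψ hφ)) _
  · push Not at h
    have h0 : ∀ φ : Fin n ↪ (Fin 3 → Fin m), {z : Config n (Fin 3) V3 | ∀ i, (z i).1 ∈ cellCore ℓ R (φ i)}.indicator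
        (fun z => ENNReal.ofReal (Real.exp (2 * ∑ i, g (z i).2))) z = 0 := fun φ => by
      obtain ⟨i, hi⟩ := h φ
      exact indicator_of_notMem (fun hφ : ∀ i, (z i).1 ∈ cellCore ℓ R (φ i) => hi (hφ i)) _
    rw [Finset.sum_eq_zero fun φ _ => h0 φ]
    exact bot_le

/-- `CellForecastPressureDecay` with the range threshold `R₀` chosen BEFORE the tolerance `δ`: the
quantifier block `∀ δ ∃ T ∃ R₀ ∀ R ≥ R₀` of the crux is replaced by `∃ R₀ ∀ δ ∃ T ∀ R ≥ R₀`
(everything else verbatim). A natural strengthening: "one range serves every tolerance". -/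
def CellForecastPressureDecayFixedRange : Prop :=
  ∃ σ₀ : ℝ, 0 < σ₀ ∧ ∀ σ : ℝ, 0 < σ → σ < σ₀ → ∃ κ : ℝ, 0 < κ ∧ ∀ g : Literature.MathematicalPhysics.KineticTheory.V3 → ℝ, Continuous g → (∀ v, |g v| ≤ κ) → (∀ (c₀ c₂ : ℝ) (b : Literature.MathematicalPhysics.KineticTheory.V3), ∫ v, g v * (c₀ + inner ℝ b v + c₂ * ‖v‖ ^ 2) ∂(ProbabilityTheory.stdGaussian Literature.MathematicalPhysics.KineticTheory.V3) = 0) → ∃ R₀ : ℝ, 0 < R₀ ∧ ∀ δ : ℝ, 0 < δ → ∃ T : ℝ, 0 < T ∧ ∀ R : ℝ, R₀ ≤ R → ∃ L₀ : ℝ, 0 < L₀ ∧ ∀ L : ℝ, L₀ ≤ L → ∀ n : ℕ, (n : ℝ) ≤ 2 * L ^ 3 → ∀ (Ψ : (k : ℕ) → Literature.Analysis.FluidPDE.HardSphereFlow (Literature.Analysis.FluidPDE.Euclidean.geometry (Fin 3)) σ k) (c : ℝ), |c| ≤ 1 → ∫⁻ z, ENNReal.ofReal (Real.exp (2 * c *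 ∑ i : Fin n, T⁻¹ * ∫ t in (0 : ℝ)..T, g (Literature.Analysis.FluidPDE.localClusterState Ψ R t z i).2)) ∂(Literature.Analysis.FluidPDE.particleLaw (Ψ n) (Literature.Analysis.FluidPDE.canonicalDensity (Literature.Analysis.FluidPDE.Euclidean.geometry (Fin 3)) σ n (fun p => Set.indicator {x : Literature.MathematicalPhysics.KineticTheory.V3 | ∀ k, x k ∈ Set.Icc (0 : ℝ) L} (fun _ => (1 : ℝ)) p.1 * Literature.Analysis.FluidPDE.globalMaxwellian p.2))) ≤ ENNReal.ofReal (Real.exp (δ * L ^ 3))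

/-- Sanity: the fixed-range variant implies the crux (it is the crux with `∃ R₀` moved outward). -/
theorem cellForecastPressureDecay_of_fixedRange (h : CellForecastPressureDecayFixedRange) :
    Summit.AtomisticToContinuum.HydrodynamicLimit.Theses.AntiMazurCoboundaries.CellForecastPressureDecay := by
  obtain ⟨σ₀, hσ₀, h⟩ := h
  refine ⟨σ₀, hσ₀, fun σ hσ hσ' => ?_⟩
  obtain ⟨κ, hκ, h⟩ := h σ hσ hσ'
  refine ⟨κ, hκ, fun g hg hgb horth δ hδ => ?_⟩
  obtain ⟨R₀, hR₀, h⟩ := h g hg hgb horth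
  obtain ⟨T, hT, h⟩ := h δ hδ
  exact ⟨T, hT, R₀, hR₀, h⟩

/-- **The fixed-range floor** (`R₀` must grow as `δ → 0`; dynamics-free and EXTENSIVE). With
`∃ R₀` before `∀ δ` the statement is false. Witness: `g = κ sin v₀ sin v₁` (admissible,
`J = ∫ e^{2g} dγ = 1 + λ > 1`), `R = max R₀ 1`, cells of side `ℓ = K R` (`K = ⌈8(1+λ)/λ⌉ + 2`),
`L = m ℓ`, `n = ⌊m³/K⌋` particles (density `1/(K ℓ³)`), `c = 1`, ANY horizon `T`. On the event
"particle `i` lies in the core (side `ℓ - R`) of cell `φ i`", `φ` injective, all range-`R` clusters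
are singletons, every forecast is free flight, and the window average of `g` is `g(v_i)`; summing
over the `m³!/(m³-n)!` assignments, `∫⁻ e^{2∑A_i} dP ≥ (m³-n)ⁿ ((ℓ-R)³ J)ⁿ / L^{3n} ≥ ((1-1/K)⁴ J)ⁿ
≥ (1 + λ/2)ⁿ > e^{δ L³}` for `δ = log(1+λ/2)/(4Kℓ³)`. So at fixed range the functional has a
`T`-independent extensive floor (isolated particles never thermalise): any proof must let
`R₀ → ∞` as `δ → 0` (quantitatively `R₀³ ≳ λ⁵/δ`), not only `R₀ ≫ T`. -/
theorem cellForecastPressureDecay_false_fixedRange : ¬ CellForecastPressureDecayFixedRange := by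
  rintro ⟨σ₀, hσ₀, h⟩
  set σ : ℝ := min (σ₀ / 2) (3 / 16) with hσdef
  have hσpos : 0 < σ := by positivity
  have hσlt : σ < σ₀ := (min_le_left _ _).trans_lt (by linarith)
  have hσ' : σ ≤ 3 / 16 := min_le_right _ _
  obtain ⟨κ, hκ, h⟩ := h σ hσpos hσlt
  obtain ⟨R₀, hR₀, h⟩ := h (gW κ) (continuous_gW κ) (abs_gW_le hκ.le) (gW_orthogonal κ)
  -- the static exponential moment `J = ∫ e^{2g} dγ = 1 + λ > 1`
  set J : ℝ := ∫ v, Real.exp (2 * gW κ v) ∂stdGaussian V3 with hJdef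
  have hJ1 : 1 < J := one_lt_integral_exp_gW hκ.ne'
  set lam : ℝ := J - 1 with hlamdef
  have hlam : 0 < lam := by rw [hlamdef]; linarith
  have hJlam : J = 1 + lam := by rw [hlamdef]; ring
  have hJM : ∫ v, globalMaxwellian v * Real.exp (2 * gW κ v) = J := by
    rw [hJdef, integral_stdGaussian_eq_integral_mul_globalMaxwellian]
  -- geometry: range `R`, cell side `ℓ = K R`
  set R : ℝ := max R₀ 1 with hRdef
  have hR1 : 1 ≤ R := le_max_right _ _
  have hR0 : 0 ≤ R := by linarith
  have hσR : σ ≤ R := by linarith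
  set K : ℕ := ⌈8 * (1 + lam) / lam⌉₊ + 2 with hKdef
  have hK8 : 8 * (1 + lam) / lam ≤ K := by
    rw [hKdef]; push_cast; linarith [Nat.le_ceil (8 * (1 + lam) / lam)]
  have h8 : (8 : ℝ) ≤ 8 * (1 + lam) / lam := by
    rw [le_div_iff₀ hlam]; linarith
  have hK10 : (10 : ℝ) ≤ K := by
    rw [hKdef]; push_cast; linarith [Nat.le_ceil (8 * (1 + lam) / lam)]
  have hKpos : (0 : ℝ) < K := by linarith
  have hKne : (K : ℝ) ≠ 0 := hKpos.ne'
  set ℓ : ℝ := K * R with hℓdef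
  have hK1 : (1 : ℝ) ≤ K := by linarith
  have hℓ1 : 1 ≤ ℓ := by rw [hℓdef]; exact one_le_mul_of_one_le_of_one_le hK1 hR1
  have hℓ0 : 0 ≤ ℓ := by linarith
  have hℓpos : 0 < ℓ := by linarith
  have hRℓ : R ≤ ℓ := by rw [hℓdef]; exact le_mul_of_one_le_left hR0 hK1
  -- tolerance chosen AFTER `R₀` (this is what the fixed-range variant allows)
  have hlog : 0 < Real.log (1 + lam / 2) := Real.log_pos (by linarith)
  set δ : ℝ := Real.log (1 + lam / 2) / (4 * K * ℓ ^ 3) with hδdef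
  have hδ : 0 < δ := by positivity
  obtain ⟨T, hT, h⟩ := h δ hδ
  obtain ⟨L₀, hL₀, h⟩ := h R (le_max_left _ _)
  -- volume: `L = m ℓ`, `m ≥ 2K` cells per side
  set m : ℕ := ⌈L₀ / ℓ⌉₊ + 2 * K with hmdef
  have hm2K : (2 : ℝ) * K ≤ m := by
    rw [hmdef]; push_cast; linarith [Nat.cast_nonneg (α := ℝ) ⌈L₀ / ℓ⌉₊]
  have hm1 : (1 : ℝ) ≤ m := by linarith
  have hmpos : (0 : ℝ) < m := by linarith
  set L : ℝ := (m : ℝ) * ℓ with hLdef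
  have hLL₀ : L₀ ≤ L := by
    have h1 : L₀ / ℓ ≤ m := by
      rw [hmdef]; push_cast; linarith [Nat.le_ceil (L₀ / ℓ), (Nat.cast_nonneg K : (0 : ℝ) ≤ K)]
    rw [div_le_iff₀ hℓpos] at h1
    rw [hLdef]; linarith
  have hL1 : 1 ≤ L := by rw [hLdef]; exact one_le_mul_of_one_le_of_one_le hm1 hℓ1
  have hL0 : 0 ≤ L := by linarith
  have hL3 : L ^ 3 = (m : ℝ) ^ 3 * ℓ ^ 3 := by rw [hLdef]; ring
  -- particle number `n = ⌊m³/K⌋`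
  set M : ℕ := m ^ 3 with hMdef
  have hMR : (M : ℝ) = (m : ℝ) ^ 3 := by rw [hMdef]; push_cast; ring
  have hMpos : (0 : ℝ) < M := by rw [hMR]; positivity
  have hM2K : (2 : ℝ) * K ≤ M := by
    rw [hMR]; linarith [le_self_pow₀ hm1 three_ne_zero]
  set nn : ℕ := M / K with hndef
  have hnM : nn ≤ M := Nat.div_le_self _ _
  have hnle : (nn : ℝ) ≤ (M : ℝ) / K := by
    rw [le_div_iff₀ hKpos]; exact_mod_cast Nat.div_mul_le_self M K
  have hnge : (M : ℝ) / K - 1 ≤ nn := by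
    have h1 : ((nn * K + M % K : ℕ) : ℝ) = M := by exact_mod_cast Nat.div_add_mod' M K
    have h2 : ((M % K : ℕ) : ℝ) < K := by
      exact_mod_cast Nat.mod_lt M (by exact_mod_cast hKpos : 0 < K)
    push_cast at h1
    rw [div_sub_one hKne, div_le_iff₀ hKpos]
    linarith
  have hn2 : (nn : ℝ) ≤ 2 * L ^ 3 := by
    have h1 : (nn : ℝ) ≤ M := by exact_mod_cast hnM
    have h2 : (m : ℝ) ^ 3 ≤ L ^ 3 := by
      rw [hLdef]; exact pow_le_pow_left₀ hmpos.le (le_mul_of_one_le_right hmpos.le hℓ1) 3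
    rw [hMR] at h1
    linarith only [h1, h2, pow_nonneg hL0 3]
  set Ψ : (k : ℕ) → HardSphereFlow (Euclidean.geometry (Fin 3)) σ k :=
    fun k => (HardSphereFlow.nonempty_holds hσpos k).some with hΨ
  have key := h L hLL₀ nn hn2 Ψ 1 (by simp)
  rw [← cellRef_eq] at key
  -- the partition function
  set Z : ℝ := canonicalPartition (Euclidean.geometry (Fin 3)) σ nn (cellRef L) with hZdef
  have hZpos : 0 < Z := canonicalPartition_cell_pos hσ' hL1 hn2
  have hZle : Z ≤ (L ^ 3) ^ nn := canonicalPartition_cell_le σ hL0 nn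
  -- LOWER BOUND by the isolated-particles events
  set X : ℝ := (ℓ - R) ^ 3 * J with hXdef
  have hX0 : 0 ≤ X := mul_nonneg (pow_nonneg (by linarith) 3) (by linarith)
  have hlow : (Fintype.card (Fin nn ↪ (Fin 3 → Fin m)) : ℝ≥0∞) * ENNReal.ofReal (Z⁻¹ * X ^ nn) ≤
      ∫⁻ z, ENNReal.ofReal (Real.exp (2 * 1 * ∑ i : Fin nn, T⁻¹ * ∫ t in (0 : ℝ)..T,
        gW κ (localClusterState Ψ R t z i).2))
        ∂(particleLaw (Ψ nn) (canonicalDensity (Euclidean.geometry (Fin 3)) σ nn (cellRef L))) := by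
    calc (Fintype.card (Fin nn ↪ (Fin 3 → Fin m)) : ℝ≥0∞) * ENNReal.ofReal (Z⁻¹ * X ^ nn)
        = ∑ φ : Fin nn ↪ (Fin 3 → Fin m), ∫⁻ z, {z : Config nn (Fin 3) V3 | ∀ i, (z i).1 ∈ cellCore ℓ R (φ i)}.indicator
            (fun z => ENNReal.ofReal (Real.exp (2 * ∑ i, gW κ (z i).2))) z
            ∂(particleLaw (Ψ nn) (canonicalDensity (Euclidean.geometry (Fin 3)) σ nn (cellRef L))) := by
          rw [Finset.sum_congr rfl fun φ _ => lintegral_isoEvent hℓ0 hR0 hσR hRℓ hLdef (Ψ nn)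
              (continuous_gW κ) (abs_gW_le hκ.le) φ, Finset.sum_const, Finset.card_univ, nsmul_eq_mul,
            hJM, ← hXdef, ← hZdef]
      _ = ∫⁻ z, ∑ φ : Fin nn ↪ (Fin 3 → Fin m), {z : Config nn (Fin 3) V3 | ∀ i, (z i).1 ∈ cellCore ℓ R (φ i)}.indicator
            (fun z => ENNReal.ofReal (Real.exp (2 * ∑ i, gW κ (z i).2))) z
            ∂(particleLaw (Ψ nn) (canonicalDensity (Euclidean.geometry (Fin 3)) σ nn (cellRef L))) :=
          (lintegral_finsetSum _ fun φ _ => (measurable_expSum (continuous_gW κ)).indicator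
            (measurableSet_isoEvent ℓ R φ)).symm
      _ ≤ _ := lintegral_mono fun z => sum_indicator_le_cruxIntegrand hℓ0 hR0 hT.ne' Ψ (gW κ) z
  have hfin := hlow.trans key
  rw [← ENNReal.ofReal_natCast, ← ENNReal.ofReal_mul (Nat.cast_nonneg _),
    ENNReal.ofReal_le_ofReal_iff (Real.exp_pos _).le] at hfin
  -- hfin : card * (Z⁻¹ * X ^ nn) ≤ exp (δ * L ^ 3).  Now the real arithmetic.
  -- (i) the number of injective assignments
  have hcard : ((M : ℝ) - nn) ^ nn ≤ (Fintype.card (Fin nn ↪ (Fin 3 → Fin m)) : ℝ) := by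
    have h1 : Fintype.card (Fin nn ↪ (Fin 3 → Fin m)) = M.descFactorial nn := by
      rw [Fintype.card_embedding_eq]
      simp only [Fintype.card_fun, Fintype.card_fin]
      rw [hMdef]
    have h2 : (M - nn) ^ nn ≤ M.descFactorial nn :=
      (Nat.pow_le_pow_left (by omega) nn).trans (Nat.pow_sub_le_descFactorial M nn)
    have h3 : (((M - nn) ^ nn : ℕ) : ℝ) ≤ (M.descFactorial nn : ℝ) := by exact_mod_cast h2
    rw [h1]
    push_cast [Nat.cast_sub hnM] at h3
    exact h3
  -- (ii) the per-particle ratio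
  have hratio : (1 + lam / 2) ≤ ((M : ℝ) - nn) * X / L ^ 3 := by
    have hMn : (M : ℝ) * ((K - 1) / K) ≤ (M : ℝ) - nn := by
      have : (M : ℝ) * ((K - 1) / K) = M - M / K := by field_simp
      rw [this]; linarith
    have hX : X = ((K : ℝ) - 1) ^ 3 * R ^ 3 * J := by rw [hXdef, hℓdef]; ring
    have hL3' : L ^ 3 = (M : ℝ) * (K : ℝ) ^ 3 * R ^ 3 := by rw [hL3, hMR, hℓdef]; ring
    have hK1 : (0 : ℝ) ≤ (K : ℝ) - 1 := by linarith
    have hstep : (((K : ℝ) - 1) / K) ^ 4 * J ≤ ((M : ℝ) - nn) * X / L ^ 3 := by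
      rw [hX, hL3', le_div_iff₀ (by positivity)]
      have hJ0 : (0 : ℝ) ≤ J := by linarith
      have := mul_le_mul_of_nonneg_right hMn (by positivity : (0 : ℝ) ≤ ((K : ℝ) - 1) ^ 3 * R ^ 3 * J)
      calc (((K : ℝ) - 1) / K) ^ 4 * J * ((M : ℝ) * (K : ℝ) ^ 3 * R ^ 3)
          = (M : ℝ) * ((K - 1) / K) * (((K : ℝ) - 1) ^ 3 * R ^ 3 * J) := by
            field_simp
        _ ≤ ((M : ℝ) - nn) * (((K : ℝ) - 1) ^ 3 * R ^ 3 * J) := this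
    have hbern : 1 - 4 / (K : ℝ) ≤ (((K : ℝ) - 1) / K) ^ 4 := by
      have hb := one_add_mul_le_pow (a := -(1 / (K : ℝ))) (by
        have : 1 / (K : ℝ) ≤ 1 := by rw [div_le_one hKpos]; linarith
        linarith) 4
      have e1 : ((K : ℝ) - 1) / K = 1 + -(1 / (K : ℝ)) := by
        field_simp
        ring
      have e2 : (1 : ℝ) - 4 / K = 1 + (4 : ℕ) * -(1 / (K : ℝ)) := by
        push_cast
        ring
      rw [e1, e2]
      exact hb
    have hgain : 1 + lam / 2 ≤ (1 - 4 / (K : ℝ)) * J := by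
      rw [hJlam]
      have h4 : 4 * (1 + lam) / K ≤ lam / 2 := by
        rw [div_le_iff₀ hKpos]
        rw [div_le_iff₀ hlam] at hK8
        linarith
      have : (1 - 4 / (K : ℝ)) * (1 + lam) = 1 + lam - 4 * (1 + lam) / K := by ring
      rw [this]; linarith
    have hJ0 : (0 : ℝ) ≤ J := by linarith
    calc 1 + lam / 2 ≤ (1 - 4 / (K : ℝ)) * J := hgain
      _ ≤ (((K : ℝ) - 1) / K) ^ 4 * J := mul_le_mul_of_nonneg_right hbern hJ0
      _ ≤ ((M : ℝ) - nn) * X / L ^ 3 := hstep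
  -- (iii) assemble: card * Z⁻¹ * X^n ≥ ((M - n) X / L³)^n ≥ (1 + λ/2)^n
  have hL3pos : (0 : ℝ) < L ^ 3 := by positivity
  have hMn0 : (0 : ℝ) ≤ (M : ℝ) - nn := by
    have : (nn : ℝ) ≤ M := by exact_mod_cast hnM
    linarith
  have hmain : (1 + lam / 2) ^ nn ≤ (Fintype.card (Fin nn ↪ (Fin 3 → Fin m)) : ℝ) * (Z⁻¹ * X ^ nn) := by
    calc (1 + lam / 2) ^ nn ≤ (((M : ℝ) - nn) * X / L ^ 3) ^ nn :=
          pow_le_pow_left₀ (by linarith) hratio nn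
      _ = ((M : ℝ) - nn) ^ nn * (((L ^ 3) ^ nn)⁻¹ * X ^ nn) := by
          rw [div_pow, mul_pow]; ring
      _ ≤ ((M : ℝ) - nn) ^ nn * (Z⁻¹ * X ^ nn) := by
          refine mul_le_mul_of_nonneg_left (mul_le_mul_of_nonneg_right ?_ (pow_nonneg hX0 _))
            (pow_nonneg hMn0 _)
          exact inv_anti₀ hZpos hZle
      _ ≤ (Fintype.card (Fin nn ↪ (Fin 3 → Fin m)) : ℝ) * (Z⁻¹ * X ^ nn) :=
          mul_le_mul_of_nonneg_right hcard (mul_nonneg (inv_nonneg.2 hZpos.le) (pow_nonneg hX0 _))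
  -- (iv) but (1 + λ/2)^n > exp (δ L³) since n > M/(4K)
  have hexp : Real.exp (δ * L ^ 3) < (1 + lam / 2) ^ nn := by
    have e1 : (1 + lam / 2) ^ nn = Real.exp ((nn : ℝ) * Real.log (1 + lam / 2)) := by
      rw [Real.exp_nat_mul, Real.exp_log (by linarith)]
    rw [e1, Real.exp_lt_exp]
    have e2 : δ * L ^ 3 = Real.log (1 + lam / 2) * ((M : ℝ) / (4 * K)) := by
      rw [hδdef, hL3, hMR]; field_simp
    rw [e2]
    have h4 : (M : ℝ) / (4 * K) < nn := by
      have e3 : (M : ℝ) / K - 1 - M / (4 * K) = 3 * M / (4 * K) - 1 := by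
        field_simp
        ring
      have e4 : (1 : ℝ) < 3 * M / (4 * K) := by
        rw [one_lt_div (by positivity)]; linarith
      linarith
    rw [mul_comm (nn : ℝ)]
    exact mul_lt_mul_of_pos_left h4 hlog
  exact absurd (hmain.trans hfin) (not_le.2 hexp)
end FixedRange

/-! ## § 10 (cycle 2) The crux functional does not depend on the cluster flows `Ψ` -/

section FlowIndependence

variable {n : ℕ}

/-- Sub-configurations of hard-sphere configurations are hard-sphere configurations. [folklore] -/
theorem restrictTo_mem_hardSphereDomain {d : Type*} [Fintype d] {X : Type*} {G : Geometry d X} {σ : ℝ}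
    (S : Finset (Fin n)) {z : Config n d X} (hz : z ∈ hardSphereDomain G n σ) :
    Config.restrictTo S z ∈ hardSphereDomain G S.card σ := by
  rw [mem_hardSphereDomain] at hz ⊢
  intro i j hij
  simp only [Config.restrictTo_apply]
  exact hz _ _ fun h => hij ((S.orderEmbOfFin rfl).injective h)

/-- **Coordinate projections pull null sets back to null sets**: for a Lebesgue-null measurable
`N ⊆ Config S.card`, the configurations whose restriction to `S` lies in `N` form a Lebesgue-null set
(split the labels as `Fin S.card ⊕ Fin Sᶜ.card ≃ Fin n`, `inl m ↦ S.orderEmbOfFin m`; the restriction is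
then the first component of the measure-preserving splitting `sumPiEquivProdPi ∘ piCongrLeft⁻¹`, and
`(vol ⊗ vol)(N × univ) = 0 · ∞ = 0`). [folklore] -/
theorem volume_restrictTo_preimage_null (S : Finset (Fin n)) {N : Set (Config S.card (Fin 3) V3)}
    (hNm : MeasurableSet N) (hN : volume N = 0) :
    volume {z : Config n (Fin 3) V3 | Config.restrictTo S z ∈ N} = 0 := by
  -- index equivalence `Fin S.card ⊕ Fin Sᶜ.card ≃ Fin n`, `inl m ↦ S.orderEmbOfFin m`
  let e : Fin S.card ⊕ Fin Sᶜ.card ≃ Fin n :=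
    (Equiv.sumCongr (S.orderIsoOfFin rfl).toEquiv
      ((Sᶜ.orderIsoOfFin rfl).toEquiv.trans
        (Equiv.subtypeEquivRight (fun i => by simp [Finset.mem_compl])))).trans
      (Equiv.sumCompl fun i => i ∈ S)
  have he : ∀ m : Fin S.card, e (Sum.inl m) = S.orderEmbOfFin rfl m := by
    intro m
    simp only [e, Equiv.trans_apply, Equiv.sumCongr_apply, Sum.map_inl, Equiv.sumCompl_apply_inl]
    rfl
  let E := MeasurableEquiv.piCongrLeft (fun _ : Fin n => V3 × V3) e
  have hE := measurePreserving_piCongrLeft (fun _ : Fin n => (volume : Measure (V3 × V3))) e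
  let F := MeasurableEquiv.sumPiEquivProdPi (fun _ : Fin S.card ⊕ Fin Sᶜ.card => V3 × V3)
  have hF := measurePreserving_sumPiEquivProdPi
    (fun _ : Fin S.card ⊕ Fin Sᶜ.card => (volume : Measure (V3 × V3)))
  have hG : MeasurePreserving (F ∘ E.symm) (Measure.pi fun _ : Fin n => (volume : Measure (V3 × V3)))
      ((Measure.pi fun _ : Fin S.card => (volume : Measure (V3 × V3))).prod
        (Measure.pi fun _ : Fin Sᶜ.card => (volume : Measure (V3 × V3)))) :=
    hF.comp hE.symm
  have hfac : ∀ z : Config n (Fin 3) V3, (F (E.symm z)).1 = Config.restrictTo S z := by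
    intro z
    funext m
    rw [Config.restrictTo_apply, ← he]
    rfl
  have hset : {z : Config n (Fin 3) V3 | Config.restrictTo S z ∈ N} = (F ∘ E.symm) ⁻¹' (N ×ˢ univ) := by
    ext z
    simp only [mem_setOf_eq, mem_preimage, Function.comp_apply, mem_prod, mem_univ, and_true, hfac]
  haveI : SigmaFinite (Measure.pi fun _ : Fin Sᶜ.card => (volume : Measure (V3 × V3))) :=
    Measure.pi.sigmaFinite _
  rw [hset, volume_pi, hG.measure_preimage (hNm.prod MeasurableSet.univ).nullMeasurableSet,
    Measure.prod_prod, ← volume_pi, hN, zero_mul]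

variable {σ : ℝ}

/-- **Almost surely every sub-configuration is a good datum of the cluster flow**, under any law
`particleLaw Φ W` (these are absolutely continuous w.r.t. the Liouville measure). [folklore] -/
theorem ae_restrictTo_mem_good (Φ : HardSphereFlow (Euclidean.geometry (Fin 3)) σ n)
    (W : Config n (Fin 3) V3 → ℝ) (Ψ : (k : ℕ) → HardSphereFlow (Euclidean.geometry (Fin 3)) σ k) :
    ∀ᵐ z ∂(particleLaw Φ W), ∀ S : Finset (Fin n), Config.restrictTo S z ∈ (Ψ S.card).good := by
  rw [particleLaw_eq]
  refine (withDensity_absolutelyContinuous _ _).ae_le (?_ :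
    ∀ᵐ z ∂(liouville (Euclidean.geometry (Fin 3)) n σ), ∀ S : Finset (Fin n),
      Config.restrictTo S z ∈ (Ψ S.card).good)
  rw [liouville_eq, ae_all_iff]
  intro S
  -- null set: restriction in `D^{S.card} \ good`
  set D := hardSphereDomain (Euclidean.geometry (Fin 3)) n σ with hD
  set Dk := hardSphereDomain (Euclidean.geometry (Fin 3)) S.card σ with hDk
  have hDkm : MeasurableSet Dk := measurableSet_hardSphereDomain _ Euclidean.measurable_geometry_sepVec _ σ
  have hNm : MeasurableSet (Dk \ (Ψ S.card).good) := hDkm.diff (Ψ S.card).measurableSet_good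
  have hN : volume (Dk \ (Ψ S.card).good) = 0 := by
    have := (Ψ S.card).measure_compl_good
    rw [liouville_eq, Measure.restrict_apply (Ψ S.card).measurableSet_good.compl] at this
    rwa [sdiff_eq_compl_inter]
  have h0 := volume_restrictTo_preimage_null S hNm hN
  rw [ae_restrict_iff' (measurableSet_hardSphereDomain _ Euclidean.measurable_geometry_sepVec n σ), ae_iff]
  refine measure_mono_null (fun z hz => ?_) h0
  simp only [mem_setOf_eq, Classical.not_imp] at hz
  exact ⟨restrictTo_mem_hardSphereDomain S hz.1, hz.2⟩

/-- **Two families of cluster flows agree on common good data** at all forward times (forward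
uniqueness of hard-sphere trajectories). [folklore] -/
theorem clusterStateIn_eq_of_mem_good (Ψ Ψ' : (k : ℕ) → HardSphereFlow (Euclidean.geometry (Fin 3)) σ k)
    {S : Finset (Fin n)} {z : Config n (Fin 3) V3} (hz : Config.restrictTo S z ∈ (Ψ S.card).good)
    (hz' : Config.restrictTo S z ∈ (Ψ' S.card).good) (m : Fin S.card) {t : ℝ} (ht : 0 ≤ t) :
    clusterStateIn Ψ S m t z = clusterStateIn Ψ' S m t z := by
  rw [clusterStateIn_of_mem_good Ψ m t hz, clusterStateIn_of_mem_good Ψ' m t hz']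
  have h0 : (Ψ S.card).flow 0 (Config.restrictTo S z) = (Ψ' S.card).flow 0 (Config.restrictTo S z) := by
    rw [(Ψ S.card).flow_zero _ hz, (Ψ' S.card).flow_zero _ hz']
  have := IsHardSphereTrajectory.unique_holds ((Ψ S.card).isTrajectory _ hz)
    ((Ψ' S.card).isTrajectory _ hz') h0 (Set.mem_Ici.2 ht)
  exact congrFun this m

/-- On common good data the local cluster states (the crux's forecasts) agree at forward times. [folklore] -/
theorem localClusterState_eq_of_mem_good
    (Ψ Ψ' : (k : ℕ) → HardSphereFlow (Euclidean.geometry (Fin 3)) σ k) {R : ℝ} {z : Config n (Fin 3) V3}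
    (hz : ∀ S : Finset (Fin n), Config.restrictTo S z ∈ (Ψ S.card).good)
    (hz' : ∀ S : Finset (Fin n), Config.restrictTo S z ∈ (Ψ' S.card).good) (i : Fin n) {t : ℝ}
    (ht : 0 ≤ t) : localClusterState Ψ R t z i = localClusterState Ψ' R t z i := by
  unfold localClusterState
  exact clusterStateIn_eq_of_mem_good Ψ Ψ' (hz _) (hz' _) _ ht

/-- **The crux functional is independent of the cluster flows.** For any two families `Ψ, Ψ'` of
Euclidean hard-sphere flows, any initial density `W`, range `R`, horizon `T ≥ 0`, observable `g` and
tilt `c`, the crux's left-hand side is the same (and `particleLaw (Ψ n) W = particleLaw (Ψ' n) W`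
definitionally). [folklore] -/
theorem lintegral_cruxFunctional_eq (Ψ Ψ' : (k : ℕ) → HardSphereFlow (Euclidean.geometry (Fin 3)) σ k)
    (W : Config n (Fin 3) V3 → ℝ) (R : ℝ) {T : ℝ} (hT : 0 ≤ T) (g : V3 → ℝ) (c : ℝ) :
    ∫⁻ z, ENNReal.ofReal (Real.exp (2 * c * ∑ i : Fin n, T⁻¹ * ∫ t in (0 : ℝ)..T,
        g (localClusterState Ψ R t z i).2)) ∂(particleLaw (Ψ n) W) =
      ∫⁻ z, ENNReal.ofReal (Real.exp (2 * c * ∑ i : Fin n, T⁻¹ * ∫ t in (0 : ℝ)..T,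
        g (localClusterState Ψ' R t z i).2)) ∂(particleLaw (Ψ' n) W) := by
  have hlaw : particleLaw (Ψ n) W = particleLaw (Ψ' n) W := rfl
  rw [hlaw]
  refine lintegral_congr_ae ?_
  filter_upwards [ae_restrictTo_mem_good (Ψ' n) W Ψ, ae_restrictTo_mem_good (Ψ' n) W Ψ'] with z hz hz'
  congr 3
  refine Finset.sum_congr rfl fun i _ => ?_
  congr 1
  refine intervalIntegral.integral_congr fun t ht => ?_
  rw [uIcc_of_le hT] at ht
  simp only [localClusterState_eq_of_mem_good Ψ Ψ' hz hz' i ht.1]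

end FlowIndependence

/-! ## Targets — line `tilt-analyticity-transfer` (PICKED.md, 2026-08-16; skeleton
`Cruxes/CellForecastPressureDecay/Lines/tilt-analyticity-transfer.lean`), cycle-2 read of the three stubs

No stub is broken; findings for the lead (cheap arsenal: small models `n = 0, 1, 2`, collisionless /
crossover / dense density regimes, quantifier order against §§ 8–9, junk values):

* `stub_koteckyPreissLog` (abstract). TRUE — it is Kotecký–Preiss with `a(B) = a|B|` for the subset
  polymer gas (activities `κ_B(c)` entire in `c` because the `w_j` are bounded; `q` := the cluster
  expansion, holomorphic by locally uniform majorisation `≤ a·n`, or the skeleton's Dobrushin route).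
  Small models check: `n = 0` (`Z ≡ 1`, `q = 0`, bound `a·0 = 0` ✓); `n = 1` (hypothesis
  `‖E e^{2cw} − 1‖ ≤ a e^{−a} < 1`, `q = Log(1 + m)`, `‖q‖ ≤ −log(1 − ae^{−a}) ≤ a` because
  `e^{a} ≥ 1 + a` ✓); `n = 2` with DEPENDENT `w₀, w₁` (`Ξ = (1+κ₀)(1+κ₁) + κ₀₁` = the polymer sum ✓).
  Not attackable; size "known theorem" is right.
* `stub_siteSummableLabelCumulants` (the open content). Cheap regimes consistent: singleton term
  `(e^{4κ}−1)e^{a} ≤ a` forces `κ ≤ ¼ log(1 + e^{−1−a}·a…)`, i.e. the `∃κ` IS consumed here (as the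
  docstring says); order 2 at the crossover density `ρ* ≍ 1/(σ² v̄ T)` (one collision per particle per
  window): `Σ_j |κ_{ij}| ≍ P(i meets j)·O(κ²)·n ≍ κ²` — BOUNDED, NOT decaying (the docstring's
  `(t_mf/T)` decay holds only in the collisional regime `ρ ≫ ρ*`; at `ρ*` there is no decay in `T`,
  which is fine because the stub asks only boundedness — but a STRENGTHENING of stub 1 with a factor
  `→ 0` in `T` uniformly in `n ≤ 2L³` would be FALSE on paper at `ρ = ρ*(T)`); order `k` at `ρ*`:
  collision trees with branching `O(1)`, `Σ_{|B|=k} ≍ C^k κ^k` — geometric, consistent with `e^{a|B|}`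
  summability for `κ e^{a} C < 1`. Isolated particles (§ 9) contribute only singleton cumulants
  (independent labels): the fixed-range floor does not bite stub 1. No refutation short of the crux's
  own open content (a persistent many-label correlation at fixed σ).
* `stub_fixedOrderCumulantDecay`. `k = 0` trivial (`q 0 = 0`); `k = 1`: `2E[Σaᵢ]/L³` — bulk zero only
  APPROXIMATELY (finite speed of influence), boundary/vacuum layer `O(ρ v̄ T κ L²)/L³ → 0` since `L₀`
  is after `T` ✓; `k = 2`: per-volume variance `≤ Var(g)·sup_ρ ρ min(1, t_mf(ρ)/T) ≲ Var(g)/(σ² v̄ T) → 0`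
  ✓ in the cheap regimes; the § 9 floor says that at FIXED range `Var(Σaᵢ)/L³ ≥ ρ Var(g) P(isolated) > 0`
  uniformly in `T` (at `ρ ≍ R⁻³`, `≍ Var(g) e^{−4}/R³`), so the stub's `R₀` MUST grow as `η → 0`
  (`R₀³ ≳ Var(g)/η`) — its quantifier order (`R₀` after `η` and `T`) allows this ✓, but a prover must
  not try to take `R₀ = R₀(T)` only. Junk: if `Z` vanishes in `ball 0 r` no `q` exists and the clause is
  vacuous (harmless); `iteratedDeriv k q 0` is the genuine jet since `0` is interior. Not attackable
  cheaply; `k = 2` is the L² wall (cell twin of 10952).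
-/

end

end Summit.AtomisticToContinuum.HydrodynamicLimit.Cruxes.CellForecastPressureDecay.Disproof
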